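import Literature.AlgebraicGeometry.Movasati2017.PeriodMatrixRankLowerBound
import Literature.AlgebraicGeometry.Villaflor2022.RationalPeriodRatios
import Mathlib.Data.Fintype.Sum
import HarnessLib

/-!
# Linear forms in the Gorenstein ideal of a Hodge class cut a linear cycle (Villaflor, CCM 2022, Thm. 1.2 / 1.1)

R. Villaflor Loyola, *Small codimension components of the Hodge locus containing the Fermat variety*,
Commun. Contemp. Math. 24 (2022) 2150053 = arXiv:2001.01019 [Villaflorloyola2021] (held text pp. 4–12).
J. Duque Franco, R. Villaflor Loyola, *On fake linear cycles inside Fermat varieties*, Algebra Number Theory 17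
(2023) 1847–1865 = arXiv:2112.14818 [DuquefrancoVillaflorloyola2023] (Lemma 4.1, held text p. 9).

> **Theorem 1.2.** Let `F = x_0^d + ⋯ + x_{n+1}^d` and `X = {F = 0}` be the Fermat variety of even dimension `n`
> and degree `d` such that `ζ_d + ζ_d^{−1} ∉ ℚ` (i.e. `d ≠ 1,2,3,4,6`). Let `λ ∈ H^{n/2,n/2}(X,ℤ)` be a non-trivial
> Hodge cycle such that there exist `L_1, …, L_{n/2+1} ∈ J^{F,λ}_1` linearly independent. Then
> `ℙ^{n/2} := {L_1 = ⋯ = L_{n/2+1} = 0} ⊆ X`.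
>
> **Theorem 1.1** […] `codim_{T_0T} T_0V_λ = C(n/2+d, d) − (n/2+1)²` if and only if `λ(0)_prim = a[ℙ^{n/2}]_prim`
> for some `ℙ^{n/2} ⊆ X_0` and some `a ∈ ℚ^×`.
>
> **Proposition 4.2** […] If there exist `L_1, …, L_{n/2+1} ∈ J^{F,λ}_1` linearly independent such that
> `ℙ^{n/2} := {L_1 = ⋯ = 0} ⊆ X`, then `λ_prim = c·[ℙ^{n/2}]_prim` and so `V_λ = V_{[ℙ^{n/2}]}`.
>
> **Proposition 5.3** […] there exist `c_λ ∈ ℂ^×` and `a_0, a_2, …, a_n ∈ ℂ` such that up to a permutation of the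
> coordinates `P_λ = c_λ ∏_{j=1}^{n/2+1} (x_{2j−2}^{d−1} − (a_{2j−2} x_{2j−1})^{d−1})/(x_{2j−2} − a_{2j−2} x_{2j−1})`.
> **Remark 5.1.** `J^{F,λ} = (J^F : P_λ) = ⟨x_0 − a_0x_1, x_2 − a_2x_3, …, x_n − a_nx_{n+1}, x_1^{d−1}, …, x_{n+1}^{d−1}⟩`
> […] we have to show that `a_i^d + 1 = 0` for all `i`.
>
> *Proof of Theorem 1.2* (p. 12): by Props. 5.1–5.2 [VillaPCIAC], for every linear cycle `δ = [ℙ^{n/2}_α]` of `X`,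
> `P_λ · P_δ ≡ c_α (x_0 ⋯ x_{n+1})^{d−2} (mod J^F)`, `c_α = c_λ c_δ ζ_{2d}^{α_0+⋯+α_n} ∏_j (a^{d−1} − ζ^{α(d−1)})/(a − ζ^{α}) ∈ ℚ`;
> "`c_β/c_{β'} = (a_i^{d−1}+ζ^r)(a_iζ^s−1)/((a_i^{d−1}+ζ^s)(a_iζ^r−1)) ∈ ℚ` for all `r, s` … and the result follows from
> Proposition 5.4."

## The level of this formalisation (as in the tree's Movasati2016/2017, MovasatiVillaflor2018, DFV files)

Everything is algebra on Movasati's period data at the Fermat point: a Hodge class `λ` enters only through its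
period functional `ℓ = ℓ_λ : K[x_0, …, x_{n+1}] → K` (`ℓ(x^β) = p_β(λ)`; [Movasati2016Periods] Def. 1,
[Villaflorloyola2021] Def. 2.1), which kills the monomials of `J^F = (x_i^{d−1})`, is concentrated in degree
`σ = (n/2+1)(d−2)` and has `Ann(ℓ) = J^{F,λ}` (tree `Kloosterman2025.annIdeal`; `P_λ` = the Gorenstein dual of `ℓ`,
tree `span_X_pow_colon_eq_annIdeal`). The TRANSCENDENTAL inputs are cited, not formalised:
(T1) Prop. 2.1: `T_0V_λ = J^{F,λ}_d`; (T2) Prop. 5.1 ([Villaflor2022PeriodsCI]): for rational Hodge cycles `λ, μ`,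
`P_λ P_μ ≡ c·det Hess(F)` with `c ∈ ℚ` — i.e. `ℓ_λ(P_μ) ∈ ℚ` up to one universal constant; (T3) Prop. 5.2
([Villaflor2022PeriodsCI], [MovasatiVillaflor2018] Thm. 1): the polynomial of the linear cycle
`{x_{θ(j)} = c_j x_{θ(j')}}` is `c_δ·(∏_j c_j)·∏_j (x_{θ j}^{d−1} − (c_j x_{θ j'})^{d−1})/(x_{θ j} − c_j x_{θ j'})`,
`c_δ ∈ ℚ^×` — the tree's `HodgeTheory.fermatLinearCyclePolynomial` transported along the pairing `θ`
(`linearCyclePolynomial` below). So the hypothesis "`λ` is a rational Hodge cycle" becomes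

  (H2) `∃ c₀, ∀` linear cycles `(θ, c)` of `X` (`c_j^d = −1`), `ℓ(linearCyclePolynomial θ c) ∈ ℚ·c₀`.

## What this file PROVES (0 facts, 0 sorry), `K` any field of characteristic `0`, `m = 2k+2 = n+2` variables

* **Prop. 5.3 / Remark 5.1, structure** (`exists_pairing_of_linearForms`): if `ℓ ≠ 0` kills `(x_i^e)` (`e = d−1 ≥ 2`),
  is concentrated in degree `(k+1)(e−1)` and `dim (Ann ℓ)_1 ≥ k+1`, then there are a set `N` of `k+1` coordinates,
  a "partner" map `p : Fin m → N` (identity on `N`) and scalars `a_i` with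
  `ℓ = c · coeff_{∏_{j∈N} x_j^{e−1}} ∘ (x_i ↦ a_i x_{p(i)})`, so `Ann ℓ = ⟨x_i − a_i x_{p(i)} (i ∉ N), x_j^e⟩` — the
  printed shape with the partner map NOT YET injective. (The printed proof of Prop. 5.3 asserts injectivity of
  `i ↦ p_{2i−2}` from the reducedness of `P_λ`; at this level of generality non-injective partner maps do occur —
  e.g. `n = 2`, `ℓ = coeff_{x_1^{d−2}x_3^{d−2}} ∘ (x_0 ↦ a x_1, x_2 ↦ b x_1)` has `HF(d) = d − 3` and two independent
  linear forms — and injectivity is obtained below from (H2), Case 1 of `exists_fakeLinearCycle_of_rational_periods`.)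
* **The periods of such an `ℓ` over adapted linear cycles** (`fermatSocleFunctional_aeval_rename_fermatLinearCyclePolynomial`,
  `smul_substFunctional_linearCyclePoly`): for a bijection `σ' : N ≃ Nᶜ` with `p ∘ σ' = id` on the image of `p|_{Nᶜ}`,
  `ℓ(P_{θ(σ'),c}) = c·∏_j c_j r_j`, `r_j = Σ_{l<e} a_{σ'j}^l c_j^{e−1−l}` if `p(σ'j) = j` and `r_j = c_j^{e−1}` otherwise —
  Villaflor's `c_α` when `p` is a bijection (`linearCyclePoly e θ c = (∏ c_j)·∏_j (x_{θ j}^e − (c_j x_{θ j'})^e)/(x_{θ j} − c_j x_{θ j'})`,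
  Prop. 5.2's `P_δ` without its rational constant `c_δ`).
* **The fake-linear-cycle shape, `d ≥ 3`** (`exists_fakeLinearCycle_of_rational_periods`; census parametrisation
  `exists_fakeLinearCycleFunctional_of_rational_periods`): `ζ` a primitive `2d`-th root of unity; `ℓ` as above with
  `dim (Ann ℓ)_1 ≥ k+1` and (H2) ⟹ `ℓ = c·coeff ∘ (x_{θ j} ↦ c_j y_j, x_{θ j'} ↦ y_j)` for a PERFECT MATCHING `θ` and
  NON-ZERO twists `c_j` — the shape `P_λ = c_λ ∏ (x_{2j−2}^{d−1} − (c_{2j−2}x_{2j−1})^{d−1})/(x_{2j−2} − c_{2j−2}x_{2j−1})`,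
  `c_{2j−2} ∈ ℂ^×`, of [DuquefrancoVillaflorloyola2023] Lemma 4.1 — together with the printed arithmetic condition
  "`c_β/c_β' ∈ ℚ`" on the period ratios in each twist. Case 2 of the proof (partner map onto) is the printed one;
  Case 1 (a free coordinate `j₀`) and `c_j = 0` are excluded because the period is then `∝ c_{j₀}^{d−1}`, so the twists
  `ζ, ζ³` give the ratio `ζ_{2d}^{2(d−1)} = ζ_d^{−1} ∈ ℚ`, impossible for `d ≥ 3`.
* **Theorem 1.2 at this level** (`exists_linearCycle_of_rational_periods`): `5 ≤ d`, `d ≠ 6`; `ℓ` as above with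
  `dim (Ann ℓ)_1 ≥ k+1` and (H2) ⟹ `ℓ = c·ℓ_δ` for the period functional `ℓ_δ` of a genuine linear cycle `δ ⊆ X`
  (all twists `c_j^d = −1`), i.e. `Ann ℓ = J^{F,[ℙ^{n/2}]} = ⟨x_{θ j} − c_j x_{θ j'}, x_i^{d−1}⟩` with `c_j^d = −1`:
  "`ℙ^{n/2} := {L_1 = ⋯ = 0} ⊆ X`" and (Prop. 4.2 / Cor. 2.3) "`λ_prim = c·[ℙ^{n/2}]_prim`" — the fake shape plus
  Prop. 5.4 (`Villaflor2022.pow_eq_neg_one_of_forall_ratio_rational`).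
* **Theorem 1.1 at this level** (`exists_linearCycle_of_rank_eq`; census parametrisation
  `exists_linearCycleFunctional_of_rank_eq` with the matrix of [Movasati2016Periods] Def. 1 / tree
  `Movasati2016.periodMatrix (n+2) d ((n/2)d−n−2) d` and the cycles `ℙ^{n/2}_{a,b}` of [MovasatiVillaflor2018]): `n` even,
  `d ≥ 2 + 6/n`, `d ∉ {3,4,6}`, `rank [p_{i+j}(λ)] = C(n/2+d,d) − (n/2+1)²` and (H2) ⟹ `ℓ = c'·ℓ_{a,b}`,
  `p(λ) = c' · p(ℙ^{n/2}_{a,b})` (tree `MovasatiVillaflor2018.linearCyclePeriod`) and `J^{F,λ} = J^{F,[ℙ^{n/2}_{a,b}]}` (tree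
  `linearCycleIdeal`); the converse is the tree's `MovasatiVillaflor2018.rank_periodMatrix_linearCycle`. Also Thm. 1.2 in
  the census parametrisation (`exists_linearCycleFunctional_of_rational_periods`).
-/

noncomputable section

open MvPolynomial Module Literature.RingTheory.MvPolynomial Literature.AlgebraicGeometry.Kloosterman2025
  Literature.AlgebraicGeometry.DuqueFrancoVillaflor2025 Literature.AlgebraicGeometry.HodgeTheory
  Literature.AlgebraicGeometry.MovasatiVillaflor2018

attribute [local instance] MvPolynomial.gradedAlgebra

namespace Literature.AlgebraicGeometry.Villaflor2022

variable {K : Type*} [Field K] {m : ℕ}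

/-! ## Step A — a coordinate complement of `(Ann ℓ)_1` (the echelon form `L_i = x_{2i−2} + l_i`) -/

/-- `U_N = span_K {x_j : j ∈ N}`, the coordinate subspace of `S_1`. [cite: Villaflorloyola2021, Proposition 5.3 (proof:
"the set `L_1,…,L_{n/2+1}` is reduced with respect to the lexicographic order … `L_i = x_{2i−2} + l_i(x_1,x_3,…,x_{n+1})`")] -/
def coordSpan (N : Finset (Fin m)) : Submodule K (MvPolynomial (Fin m) K) :=
  Submodule.span K (Set.range fun j : N => (X (j : Fin m) : MvPolynomial (Fin m) K))

/-- `x_j ∈ U_N` for `j ∈ N`. [cite: Villaflorloyola2021, Proposition 5.3 (proof)] -/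
theorem X_mem_coordSpan {N : Finset (Fin m)} {j : Fin m} (hj : j ∈ N) :
    (X j : MvPolynomial (Fin m) K) ∈ coordSpan (K := K) N :=
  Submodule.subset_span ⟨⟨j, hj⟩, rfl⟩

/-- `U_N ⊆ S_1`. [cite: Villaflorloyola2021, Proposition 5.3 (proof)] -/
theorem coordSpan_le_homogeneousSubmodule (N : Finset (Fin m)) :
    coordSpan (K := K) N ≤ homogeneousSubmodule (Fin m) K 1 := by
  refine Submodule.span_le.mpr ?_
  rintro _ ⟨j, rfl⟩
  exact (mem_homogeneousSubmodule _ _).mpr (isHomogeneous_X K (j : Fin m))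

/-- `dim U_N = #N`. [cite: Villaflorloyola2021, Proposition 5.3 (proof)] -/
theorem finrank_coordSpan (N : Finset (Fin m)) : finrank K (coordSpan (K := K) N) = N.card := by
  have hli : LinearIndependent K (fun j : N => (X (j : Fin m) : MvPolynomial (Fin m) K)) :=
    (linearIndependent_X (R := K) (σ := Fin m)).comp _ Subtype.val_injective
  rw [coordSpan, finrank_span_eq_card hli, Fintype.card_coe]

/-- `dim S_1 = m`. [folklore] -/
private theorem finrank_homogeneousSubmodule_one :
    finrank K (homogeneousSubmodule (Fin m) K 1) = m := by
  rw [Literature.RingTheory.HilbertSamuel.finrank_homogeneousSubmodule_fin]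
  simp

/-- **Echelon form of a space of linear forms.** For a subspace `V ⊆ S_1` there is a set `N` of coordinates with
`#N + dim V ≤ m` such that every variable is `x_i = v_i + u_i`, `v_i ∈ V`, `u_i ∈ span{x_j : j ∈ N}` — i.e. `V`
contains `x_i − u_i(x_N)` for all `i ∉ N` (Villaflor: "`L_i = x_{2i−2} + l_i(x_1, x_3, …, x_{n+1})`"). Proof: a
cardinality-minimal `N` with `S_1 = V + U_N` has `V ∩ U_N = 0`. [cite: Villaflorloyola2021, Proposition 5.3 (proof)] -/
theorem exists_coordSpan_compl (V : Submodule K (MvPolynomial (Fin m) K))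
    (hV : V ≤ homogeneousSubmodule (Fin m) K 1) :
    ∃ N : Finset (Fin m), N.card + finrank K V ≤ m ∧
      ∀ i : Fin m, (X i : MvPolynomial (Fin m) K) ∈ V ⊔ coordSpan N := by
  classical
  haveI hS1 : Module.Finite K (homogeneousSubmodule (Fin m) K 1) := finite_homogeneousSubmodule 1
  haveI : Module.Finite K V := Submodule.finiteDimensional_of_le hV
  set P : Finset (Fin m) → Prop := fun N => ∀ i : Fin m, (X i : MvPolynomial (Fin m) K) ∈ V ⊔ coordSpan N
    with hP
  have huniv : P Finset.univ := fun i => Submodule.mem_sup_right (X_mem_coordSpan (Finset.mem_univ i))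
  obtain ⟨N, hNmem, hNmin⟩ := Finset.exists_min_image (Finset.univ.filter P) Finset.card
    ⟨Finset.univ, Finset.mem_filter.mpr ⟨Finset.mem_univ _, huniv⟩⟩
  have hPN : P N := (Finset.mem_filter.mp hNmem).2
  refine ⟨N, ?_, hPN⟩
  haveI : Module.Finite K (coordSpan (K := K) N) :=
    Submodule.finiteDimensional_of_le (coordSpan_le_homogeneousSubmodule N)
  -- `U_N ∩ V = 0` by minimality of `N`
  have hdisj : coordSpan (K := K) N ⊓ V = ⊥ := by
    rw [Submodule.eq_bot_iff]
    intro u hu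
    obtain ⟨huU, huV⟩ := Submodule.mem_inf.mp hu
    obtain ⟨c, rfl⟩ := (Submodule.mem_span_range_iff_exists_fun K).mp huU
    by_contra hne
    obtain ⟨j₀, hj₀⟩ : ∃ j₀ : N, c j₀ ≠ 0 := by
      by_contra H
      push Not at H
      exact hne (Finset.sum_eq_zero fun j _ => by rw [H j, zero_smul])
    -- `x_{j₀} ∈ V + U_{N ∖ j₀}`
    have hrest : ∑ j ∈ Finset.univ.erase j₀, c j • (X (j : Fin m) : MvPolynomial (Fin m) K) ∈
        coordSpan (K := K) (N.erase j₀) := by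
      refine Submodule.sum_mem _ fun j hj => Submodule.smul_mem _ _ (X_mem_coordSpan ?_)
      rw [Finset.mem_erase] at hj ⊢
      exact ⟨fun h => hj.1 (Subtype.ext h), j.2⟩
    have hX : (X (j₀ : Fin m) : MvPolynomial (Fin m) K) ∈ V ⊔ coordSpan (N.erase j₀) := by
      have hsplit : c j₀ • (X (j₀ : Fin m) : MvPolynomial (Fin m) K) =
          (∑ j, c j • (X (j : Fin m) : MvPolynomial (Fin m) K)) -
            ∑ j ∈ Finset.univ.erase j₀, c j • (X (j : Fin m) : MvPolynomial (Fin m) K) := by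
        rw [← Finset.add_sum_erase _ _ (Finset.mem_univ j₀)]
        exact (add_sub_cancel_right _ _).symm
      have h1 : c j₀ • (X (j₀ : Fin m) : MvPolynomial (Fin m) K) ∈ V ⊔ coordSpan (N.erase j₀) := by
        rw [hsplit]
        exact Submodule.sub_mem _ (Submodule.mem_sup_left huV) (Submodule.mem_sup_right hrest)
      have h2 := Submodule.smul_mem _ (c j₀)⁻¹ h1
      rwa [smul_smul, inv_mul_cancel₀ hj₀, one_smul] at h2
    have hP' : P (N.erase j₀) := by
      intro i
      have hle : V ⊔ coordSpan (K := K) N ≤ V ⊔ coordSpan (N.erase j₀) := by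
        refine sup_le le_sup_left (Submodule.span_le.mpr ?_)
        rintro _ ⟨j, rfl⟩
        by_cases hj : j = j₀
        · rw [hj]; exact hX
        · exact Submodule.mem_sup_right
            (X_mem_coordSpan (Finset.mem_erase.mpr ⟨fun h => hj (Subtype.ext h), j.2⟩))
      exact hle (hPN i)
    have hlt : (N.erase j₀).card < N.card := Finset.card_erase_lt_of_mem j₀.2
    have hge := hNmin (N.erase j₀) (Finset.mem_filter.mpr ⟨Finset.mem_univ _, hP'⟩)
    omega
  -- dimension count
  have h1 := Submodule.finrank_sup_add_finrank_inf_eq (coordSpan (K := K) N) V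
  rw [hdisj, finrank_bot, add_zero, finrank_coordSpan] at h1
  have h2 : finrank K ↥(coordSpan (K := K) N ⊔ V) ≤ finrank K (homogeneousSubmodule (Fin m) K 1) :=
    Submodule.finrank_mono (sup_le (coordSpan_le_homogeneousSubmodule N) hV)
  rw [finrank_homogeneousSubmodule_one] at h2
  omega

/-! ## Step B — restriction to the linear subspace: the substitution `x_i ↦ v_i(x_N)` -/

section Substitution

variable (N : Finset (Fin m)) (v : Fin m → MvPolynomial N K)

/-- The restriction is a section of `K[x_N] ⊆ K[x]` when `v_j = x_j` on `N`.
[cite: Villaflorloyola2021, Proposition 5.3 (proof)] -/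
theorem aeval_rename_val (hvN : ∀ j : N, v j = X j) (q : MvPolynomial N K) :
    aeval v (rename ((↑) : N → Fin m) q) = q := by
  rw [aeval_rename, show v ∘ ((↑) : N → Fin m) = X from funext fun j => hvN j, aeval_X_left_apply]

/-- … hence surjective. [cite: Villaflorloyola2021, Proposition 5.3 (proof)] -/
theorem aeval_surjective (hvN : ∀ j : N, v j = X j) :
    Function.Surjective (aeval v : MvPolynomial (Fin m) K →ₐ[K] MvPolynomial N K) :=
  fun q => ⟨rename ((↑) : N → Fin m) q, aeval_rename_val N v hvN q⟩

/-- `g ≡ g(v)` modulo the linear equations `x_i − v_i`: the two algebra maps to `S/⟨x_i − v_i⟩` agree on variables.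
[cite: Villaflorloyola2021, Proposition 5.3 (proof: division by the Gröbner basis `L_i, x_{2j−1}^{d−1}`)] -/
theorem sub_rename_aeval_mem (g : MvPolynomial (Fin m) K) :
    g - rename ((↑) : N → Fin m) (aeval v g) ∈
      Ideal.span (Set.range fun i : Fin m =>
        (X i : MvPolynomial (Fin m) K) - rename ((↑) : N → Fin m) (v i)) := by
  rw [← Ideal.Quotient.eq]
  have key : Ideal.Quotient.mkₐ K (Ideal.span (Set.range fun i : Fin m =>
        (X i : MvPolynomial (Fin m) K) - rename ((↑) : N → Fin m) (v i))) =
      (Ideal.Quotient.mkₐ K _).comp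
        ((rename ((↑) : N → Fin m) : MvPolynomial N K →ₐ[K] MvPolynomial (Fin m) K).comp (aeval v)) := by
    refine MvPolynomial.algHom_ext fun i => ?_
    rw [AlgHom.comp_apply, AlgHom.comp_apply, aeval_X, Ideal.Quotient.mkₐ_eq_mk, Ideal.Quotient.eq]
    exact Ideal.subset_span ⟨i, rfl⟩
  have h := congrArg (fun f => f g) key
  simpa only [AlgHom.comp_apply, Ideal.Quotient.mkₐ_eq_mk] using h

/-- The restriction preserves degrees when the `v_i` are linear forms. [cite: Villaflorloyola2021, Proposition 5.3 (proof)] -/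
theorem isHomogeneous_aeval_of_linear (hv : ∀ i, (v i).IsHomogeneous 1) {g : MvPolynomial (Fin m) K} {n : ℕ}
    (hg : g.IsHomogeneous n) : (aeval v g).IsHomogeneous n := by
  have h := hg.aeval _ hv
  rwa [one_mul] at h

variable (e : ℕ)

/-- The pulled-back socle functional `ℓ_v(g) = coeff_{∏_{j∈N} x_j^{e−1}} g(v)` — the inverse-system generator of
`⟨x_i − v_i, x_j^e⟩` (Villaflor's `I = ⟨L_1, …, L_{n/2+1}, x_1^{d−1}, x_3^{d−1}, …⟩`, "Artinian Gorenstein of socle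
`(d−2)(n/2+1)`" by Macaulay). [cite: Villaflorloyola2021, Proposition 5.3 (proof)]
[cite: IarrobinoKanev1999, Lemma 2.14] -/
def substFunctional : MvPolynomial (Fin m) K →ₗ[K] K :=
  fermatSocleFunctional K N e ∘ₗ (aeval v : MvPolynomial (Fin m) K →ₐ[K] MvPolynomial N K).toLinearMap

/-- `ℓ_v(g) = coeff_{β₀}(g(v))`. [cite: Villaflorloyola2021, Proposition 5.3 (proof)] -/
@[simp] theorem substFunctional_apply (g : MvPolynomial (Fin m) K) :
    substFunctional N v e g = coeff (fermatSocleExponent N e) (aeval v g) := by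
  simp [substFunctional]

/-- `Ann(ℓ_v) = (aeval v)⁻¹ (x_j^e : j ∈ N)` (`e ≥ 1`, `v_j = x_j` on `N`). [cite: Villaflorloyola2021, Proposition 5.3 (proof)]
[cite: IarrobinoKanev1999, Example 5.8] -/
theorem annIdeal_substFunctional (hvN : ∀ j : N, v j = X j) (he : 1 ≤ e) :
    annIdeal (substFunctional N v e) =
      (Ideal.span (Set.range fun j : N => (X j : MvPolynomial N K) ^ e)).comap
        (aeval v : MvPolynomial (Fin m) K →ₐ[K] MvPolynomial N K) := by
  rw [substFunctional, annIdeal_comp_of_surjective _ (aeval_surjective N v hvN), annIdeal_fermatSocleFunctional he]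

/-- `ℓ_v` is concentrated in degree `#N·(e−1)`. [cite: Villaflorloyola2021, Proposition 5.3 (proof)] -/
theorem substFunctional_homogeneousComponent (hv : ∀ i, (v i).IsHomogeneous 1) (p : MvPolynomial (Fin m) K) :
    substFunctional N v e (homogeneousComponent (Fintype.card N * (e - 1)) p) = substFunctional N v e p := by
  have hvan : ∀ i, i ≠ Fintype.card N * (e - 1) →
      substFunctional N v e (homogeneousComponent i p) = 0 := by
    intro i hi
    rw [substFunctional_apply]
    exact (isHomogeneous_aeval_of_linear N v hv (homogeneousComponent_isHomogeneous i p)).coeff_eq_zero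
      (by rw [degree_fermatSocleExponent]; exact Ne.symm hi)
  conv_rhs => rw [← sum_homogeneousComponent p, map_sum]
  rw [Finset.sum_eq_single (Fintype.card N * (e - 1)) (fun i _ hi => hvan i hi) fun hN => ?_]
  rw [Finset.mem_range, not_lt] at hN
  rw [homogeneousComponent_eq_zero _ p (by omega), map_zero]

/-- `ℓ_v ≠ 0`: it takes the value `1` on `∏_{j∈N} x_j^{e−1}`. [cite: Villaflorloyola2021, Proposition 5.3 (proof)] -/
theorem substFunctional_ne_zero (hvN : ∀ j : N, v j = X j) : substFunctional N v e ≠ 0 := by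
  classical
  intro h
  have h1 := LinearMap.congr_fun h (rename ((↑) : N → Fin m) (monomial (fermatSocleExponent N e) (1 : K)))
  rw [substFunctional_apply, aeval_rename_val N v hvN, coeff_monomial, if_pos rfl, LinearMap.zero_apply] at h1
  exact one_ne_zero h1

variable {N v e}

/-- **`Ann(ℓ_v) ⊆ Ann(ℓ)`** when `Ann(ℓ)` contains the linear forms `x_i − v_i` and the powers `x_i^e`: modulo the
linear forms `g ≡ g(v)`, and `g(v) ∈ (x_j^e)` maps into `(x_i^e) ⊆ Ann ℓ` (Villaflor: "`I := ⟨L_1, …, L_{n/2+1},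
x_1^{d−1}, …, x_{n+1}^{d−1}⟩ ⊆ J^{F,λ}`"). [cite: Villaflorloyola2021, Proposition 5.3 (proof)] -/
theorem annIdeal_substFunctional_le {ℓ : MvPolynomial (Fin m) K →ₗ[K] K} (hvN : ∀ j : N, v j = X j) (he : 1 ≤ e)
    (hgen : ∀ i : Fin m, (X i : MvPolynomial (Fin m) K) - rename ((↑) : N → Fin m) (v i) ∈ annIdeal ℓ)
    (hJ : Ideal.span (Set.range fun i : Fin m => (X i : MvPolynomial (Fin m) K) ^ e) ≤ annIdeal ℓ) :
    annIdeal (substFunctional N v e) ≤ annIdeal ℓ := by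
  intro g hg
  rw [annIdeal_substFunctional N v e hvN he, Ideal.mem_comap] at hg
  have h1 : g - rename ((↑) : N → Fin m) (aeval v g) ∈ annIdeal ℓ :=
    Ideal.span_le.mpr (by rintro _ ⟨i, rfl⟩; exact hgen i) (sub_rename_aeval_mem N v g)
  have h2 : rename ((↑) : N → Fin m) (aeval v g) ∈ annIdeal ℓ := by
    have hmap := Ideal.mem_map_of_mem
      (rename ((↑) : N → Fin m) : MvPolynomial N K →ₐ[K] MvPolynomial (Fin m) K) hg
    rw [Ideal.map_span] at hmap
    refine hJ (Ideal.span_le.mpr ?_ hmap)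
    rintro _ ⟨_, ⟨j, rfl⟩, rfl⟩
    rw [SetLike.mem_coe, map_pow, rename_X]
    exact Ideal.subset_span ⟨(j : Fin m), rfl⟩
  have h3 := (annIdeal ℓ).add_mem h1 h2
  rwa [sub_add_cancel] at h3

/-- If `Ann(ℓ') ⊆ Ann(ℓ)` with `ℓ'` concentrated in degree `t'` and `ℓ ≠ 0` concentrated in degree `t`, then `t ≤ t'`
(`(S/Ann ℓ')_{>t'} = 0` would kill `ℓ`). [cite: Villaflorloyola2021, Proposition 5.3 (proof: "`soc(R) = (d−2)(n/2+1) = σ`")] -/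
theorem le_of_annIdeal_le {ℓ ℓ' : MvPolynomial (Fin m) K →ₗ[K] K} {t t' : ℕ}
    (hℓ : ∀ p, ℓ (homogeneousComponent t p) = ℓ p) (hℓ' : ∀ p, ℓ' (homogeneousComponent t' p) = ℓ' p)
    (hne : ℓ ≠ 0) (hle : annIdeal ℓ' ≤ annIdeal ℓ) : t ≤ t' := by
  by_contra h
  push Not at h
  apply hne
  refine LinearMap.ext fun p => ?_
  rw [← hℓ p, LinearMap.zero_apply]
  exact apply_eq_zero_of_mem_annIdeal
    (hle (mem_annIdeal_of_isHomogeneous_of_lt hℓ' (homogeneousComponent_isHomogeneous t p) h))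

end Substitution

/-! ## Step C — a power of a linear form in a monomial complete intersection -/

/-- `(w • x_i)^k = w^k x^{k·e_i}`. [folklore] -/
private theorem smul_X_pow_eq_monomial {τ : Type*} (i : τ) (w : K) (k : ℕ) :
    (w • (X i : MvPolynomial τ K)) ^ k = monomial (Finsupp.single i k) (w ^ k) := by
  rw [smul_eq_C_mul, mul_pow, ← map_pow, X_pow_eq_monomial, C_mul_monomial, mul_one]

/-- In two variables: the coefficient of `x^{e−1} y` in `(αx + βy)^e` is `e α^{e−1} β`.
[cite: Villaflorloyola2021, Proposition 5.3 (proof: "by expanding the following binomial …")] -/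
private theorem coeff_add_pow_two_vars [CharZero K] {e : ℕ} (he : 1 ≤ e) (α β : K) :
    coeff (Finsupp.single 0 (e - 1) + Finsupp.single 1 1)
        ((α • (X 0 : MvPolynomial (Fin 2) K) + β • X 1) ^ e) = e * α ^ (e - 1) * β := by
  rw [add_pow, coeff_sum]
  have hterm : ∀ k ∈ Finset.range (e + 1),
      coeff (Finsupp.single 0 (e - 1) + Finsupp.single 1 1)
        ((α • (X 0 : MvPolynomial (Fin 2) K)) ^ k * (β • X 1) ^ (e - k) * (e.choose k : MvPolynomial (Fin 2) K)) =
      if k = e - 1 then e * α ^ (e - 1) * β else 0 := by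
    intro k hk
    rw [smul_X_pow_eq_monomial, smul_X_pow_eq_monomial, monomial_mul, ← map_natCast C, mul_comm, C_mul_monomial,
      coeff_monomial]
    by_cases hk' : k = e - 1
    · subst hk'
      rw [if_pos, if_pos rfl, show e - (e - 1) = 1 by omega, pow_one,
        show e.choose (e - 1) = e by rw [Nat.choose_symm he, Nat.choose_one_right]]
      · ring
      · rw [show e - (e - 1) = 1 by omega]
    · rw [if_neg, if_neg hk']
      intro heq
      have := Finsupp.ext_iff.mp heq 0
      simp at this
      exact hk' this
  rw [Finset.sum_congr rfl hterm, Finset.sum_ite_eq' (Finset.range (e + 1)) (e - 1), if_pos]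
  exact Finset.mem_range.mpr (by omega)

/-- **A linear form whose `e`-th power (`e ≥ 2`) lies in the monomial complete intersection `(x_j^e)` is a multiple
of one variable** (characteristic `0`): the step "`(L_i − x_{2i−2})^{d−1} = a_{i,1}x_1^{d−1} + ⋯ + a_{i,n+1}x_{n+1}^{d−1}` … The
only possibility of this to happen is that `L_i = x_{2i−2} − a_{2i−2} x_{p_{2i−2}}`" of the proof of Prop. 5.3 — if two
coefficients `w_{j₁}, w_{j₂}` were non-zero, the coefficient `e w_{j₁}^{e−1} w_{j₂}` of `x_{j₁}^{e−1}x_{j₂}` would be a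
non-zero coefficient of a monomial not in `(x_j^e)`. [cite: Villaflorloyola2021, Proposition 5.3 (proof)] -/
theorem eq_zero_or_eq_zero_of_pow_mem_span_X_pow [CharZero K] {τ : Type*} [Fintype τ] [DecidableEq τ] {e : ℕ}
    (he : 2 ≤ e) (w : τ → K)
    (h : (∑ j, w j • (X j : MvPolynomial τ K)) ^ e ∈
      Ideal.span (Set.range fun j : τ => (X j : MvPolynomial τ K) ^ e))
    {j₁ j₂ : τ} (hne : j₁ ≠ j₂) : w j₁ = 0 ∨ w j₂ = 0 := by
  by_contra H
  push Not at H
  obtain ⟨h1, h2⟩ := H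
  -- restrict to the plane of `x_{j₁}, x_{j₂}`
  let g : τ → MvPolynomial (Fin 2) K := fun j => if j = j₁ then X 0 else if j = j₂ then X 1 else 0
  let φ : MvPolynomial τ K →ₐ[K] MvPolynomial (Fin 2) K := aeval g
  have hg1 : g j₁ = X 0 := by simp [g]
  have hg2 : g j₂ = X 1 := by simp [g, hne.symm]
  have hL : φ (∑ j, w j • (X j : MvPolynomial τ K)) = w j₁ • X 0 + w j₂ • X 1 := by
    rw [map_sum, Finset.sum_eq_add_of_mem j₁ j₂ (Finset.mem_univ _) (Finset.mem_univ _) hne]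
    · simp only [φ, map_smul, aeval_X, hg1, hg2]
    · intro j _ hj
      simp only [φ, map_smul, aeval_X, g, if_neg hj.1, if_neg hj.2, smul_zero]
  have hJ : (Ideal.span (Set.range fun j : τ => (X j : MvPolynomial τ K) ^ e)).map φ ≤
      Ideal.span (Set.range fun i : Fin 2 => (X i : MvPolynomial (Fin 2) K) ^ e) := by
    rw [Ideal.map_span]
    refine Ideal.span_le.mpr ?_
    rintro _ ⟨_, ⟨j, rfl⟩, rfl⟩
    rw [SetLike.mem_coe, map_pow]
    have hφj : φ (X j) = g j := aeval_X g j
    rw [hφj]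
    by_cases hj1 : j = j₁
    · rw [show g j = X 0 by simp [g, hj1]]
      exact Ideal.subset_span ⟨0, rfl⟩
    · by_cases hj2 : j = j₂
      · rw [show g j = X 1 by simp [g, hj2, hne.symm]]
        exact Ideal.subset_span ⟨1, rfl⟩
      · rw [show g j = 0 by simp [g, hj1, hj2], zero_pow (by omega)]
        exact zero_mem _
  have hmem : (w j₁ • (X 0 : MvPolynomial (Fin 2) K) + w j₂ • X 1) ^ e ∈
      Ideal.span (Set.range fun i : Fin 2 => (X i : MvPolynomial (Fin 2) K) ^ e) := by
    rw [← hL, ← map_pow]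
    exact hJ (Ideal.mem_map_of_mem φ h)
  have hzero : coeff (Finsupp.single 0 (e - 1) + Finsupp.single 1 1)
      ((w j₁ • (X 0 : MvPolynomial (Fin 2) K) + w j₂ • X 1) ^ e) = 0 := by
    by_contra hz
    obtain ⟨i, hi⟩ := mem_span_X_pow_iff.mp hmem _ (mem_support_iff.mpr hz)
    fin_cases i
    · simp at hi
      omega
    · simp at hi
      omega
  rw [coeff_add_pow_two_vars (by omega)] at hzero
  have he0 : (e : K) ≠ 0 := Nat.cast_ne_zero.mpr (by omega)
  exact mul_ne_zero (mul_ne_zero he0 (pow_ne_zero _ h1)) h2 hzero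

/-! ## Proposition 5.3 / Remark 5.1: the structure of `Ann ℓ` with `n/2 + 1` linear forms -/

/-- **Villaflor, Prop. 5.3 with Remark 5.1 — structure of a Gorenstein ideal containing `J^F` and `n/2+1`
independent linear forms, at the Fermat point.** Let `ℓ ≠ 0` be a functional on `K[x_0, …, x_{m−1}]`, `m = 2k+2`,
killing the monomials of `(x_i^e)` (`e = d − 1 ≥ 2`), concentrated in degree `(k+1)(e−1)` (so `Ann ℓ = J^{F,λ}` is
Artinian Gorenstein of socle `(d−2)(n/2+1)` containing `J^F`), with `dim (Ann ℓ)_1 ≥ k+1`. Then there are a set `N` of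
`k+1` coordinates, a map `p : Fin m → N` with `p j = j` on `N`, scalars `a` with `a_j = 1` on `N`, and `c ≠ 0` with
**`ℓ = c · coeff_{∏_{j∈N} x_j^{e−1}} ∘ (x_i ↦ a_i x_{p(i)})`** — so `P_λ ≡ c ∏_{i∉N} (x_i^e − (a_i x_{p i})^e)/(x_i − a_i x_{p i})`
and `Ann ℓ = ⟨x_i − a_i x_{p(i)} (i ∉ N), x_j^e⟩` (Remark 5.1's shape, BEFORE "we have to show `a_i^d + 1 = 0`"; the
partner map `p` is not asserted injective here — see the module docstring).
[cite: Villaflorloyola2021, Proposition 5.3, Remark 5.1] -/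
theorem exists_pairing_of_linearForms [CharZero K] {k e : ℕ} (hm : m = 2 * k + 2) (he : 2 ≤ e)
    (ℓ : MvPolynomial (Fin m) K →ₗ[K] K)
    (hbox : ∀ s : Fin m →₀ ℕ, (∃ i, e ≤ s i) → ℓ (monomial s 1) = 0)
    (hℓ : ∀ q, ℓ (homogeneousComponent ((k + 1) * (e - 1)) q) = ℓ q) (hne : ℓ ≠ 0)
    (hlin : k + 1 ≤ finrank K (idealDegree (annIdeal ℓ) 1)) :
    ∃ (N : Finset (Fin m)) (p : Fin m → N) (a : Fin m → K), N.card = k + 1 ∧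
      (∀ j : N, p j = j ∧ a j = 1) ∧
      ∃ c : K, c ≠ 0 ∧ ℓ = c • substFunctional N (fun i => C (a i) * X (p i)) e := by
  classical
  -- `(x_i^e) ⊆ Ann ℓ`
  have hbox' : ∀ s : Fin m →₀ ℕ, (∃ i, e + 1 - 1 ≤ s i) → ℓ (monomial s 1) = 0 :=
    fun s ⟨i, hi⟩ => hbox s ⟨i, by omega⟩
  have hJ : Ideal.span (Set.range fun i : Fin m => (X i : MvPolynomial (Fin m) K) ^ e) ≤ annIdeal ℓ := by
    refine Ideal.span_le.mpr ?_
    rintro _ ⟨i, rfl⟩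
    show (X i : MvPolynomial (Fin m) K) ^ e ∈ annIdeal ℓ
    rw [X_pow_eq_monomial]
    exact Movasati2017.monomial_mem_annIdeal_of_le ℓ hbox' ⟨i, by simp⟩
  -- Step A
  set V : Submodule K (MvPolynomial (Fin m) K) := idealDegree (annIdeal ℓ) 1 with hVdef
  have hV : V ≤ homogeneousSubmodule (Fin m) K 1 := idealDegree_le_homogeneousSubmodule _ 1
  obtain ⟨N, hcard, hN⟩ := exists_coordSpan_compl V hV
  -- the coefficients `w i` of `u_i ∈ U_N` with `x_i − u_i ∈ V`
  have hw : ∀ i : Fin m, ∃ w : N → K,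
      (X i : MvPolynomial (Fin m) K) - ∑ j, w j • X (j : Fin m) ∈ annIdeal ℓ := by
    intro i
    obtain ⟨y, hy, u, hu, hyu⟩ := Submodule.mem_sup.mp (hN i)
    obtain ⟨w, rfl⟩ := (Submodule.mem_span_range_iff_exists_fun K).mp hu
    refine ⟨w, ?_⟩
    rw [← hyu, add_sub_cancel_right]
    exact (mem_idealDegree.mp hy).1
  choose w hw using hw
  -- the substitution `v`
  let v : Fin m → MvPolynomial N K := fun i =>
    if h : i ∈ N then X ⟨i, h⟩ else ∑ j, C (w i j) * X j
  have hvN : ∀ j : N, v j = X j := fun j => by simp [v, j.2]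
  have hv1 : ∀ i, (v i).IsHomogeneous 1 := by
    intro i
    by_cases h : i ∈ N
    · simp only [v, dif_pos h]; exact isHomogeneous_X K _
    · simp only [v, dif_neg h]
      exact IsHomogeneous.sum _ _ _ fun j _ => (isHomogeneous_X K j).C_mul (w i j)
  have hgen : ∀ i : Fin m, (X i : MvPolynomial (Fin m) K) - rename ((↑) : N → Fin m) (v i) ∈ annIdeal ℓ := by
    intro i
    by_cases h : i ∈ N
    · simp only [v, dif_pos h, rename_X, sub_self]; exact zero_mem _
    · simp only [v, dif_neg h, map_sum, map_mul, rename_C, rename_X]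
      have := hw i
      simp only [smul_eq_C_mul] at this
      exact this
  -- Step B: `Ann(ℓ_v) ⊆ Ann ℓ`, degrees, `ℓ = c ℓ_v`
  have he1 : 1 ≤ e := by omega
  have hle : annIdeal (substFunctional N v e) ≤ annIdeal ℓ := annIdeal_substFunctional_le hvN he1 hgen hJ
  have hconc := substFunctional_homogeneousComponent N v e hv1
  have hdeg : (k + 1) * (e - 1) ≤ Fintype.card N * (e - 1) := le_of_annIdeal_le hℓ hconc hne hle
  have hcardN : N.card = k + 1 := by
    rw [Fintype.card_coe] at hdeg
    have h1 : k + 1 ≤ N.card := by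
      by_contra h'
      push Not at h'
      have : N.card * (e - 1) < (k + 1) * (e - 1) := Nat.mul_lt_mul_of_pos_right h' (by omega)
      omega
    omega
  have hconc' : ∀ q, substFunctional N v e (homogeneousComponent ((k + 1) * (e - 1)) q) =
      substFunctional N v e q := by
    intro q; rw [← hcardN, ← Fintype.card_coe N]; exact hconc q
  obtain ⟨c, hc⟩ := exists_eq_smul_of_annIdeal_le hconc' hℓ hle
  have hc0 : c ≠ 0 := fun h0 => hne (by rw [hc, h0, zero_smul])
  -- Step C: `v_i^e ∈ (x_j^e)`, so `v_i = a_i x_{p i}`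
  have hNne : N.Nonempty := Finset.card_pos.mp (by omega)
  obtain ⟨j₀, hj₀⟩ := hNne
  have hpow : ∀ i : Fin m, (v i) ^ e ∈ Ideal.span (Set.range fun j : N => (X j : MvPolynomial N K) ^ e) := by
    intro i
    have h1 : (X i : MvPolynomial (Fin m) K) ^ e ∈ annIdeal (substFunctional N v e) := by
      rw [hc, annIdeal_smul _ hc0] at hJ
      exact hJ (Ideal.subset_span ⟨i, rfl⟩)
    rw [annIdeal_substFunctional N v e hvN he1, Ideal.mem_comap, map_pow, aeval_X] at h1
    exact h1
  have huniq : ∀ i : Fin m, i ∉ N → ∀ j₁ j₂ : N, j₁ ≠ j₂ → w i j₁ = 0 ∨ w i j₂ = 0 := by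
    intro i hi j₁ j₂ hj
    have h := hpow i
    simp only [v, dif_neg hi, ← smul_eq_C_mul] at h
    exact eq_zero_or_eq_zero_of_pow_mem_span_X_pow he (w i) h hj
  -- the partner map and the scalars
  let p : Fin m → N := fun i =>
    if h : i ∈ N then ⟨i, h⟩ else if h' : ∃ j, w i j ≠ 0 then h'.choose else ⟨j₀, hj₀⟩
  let a : Fin m → K := fun i =>
    if i ∈ N then 1 else if h' : ∃ j, w i j ≠ 0 then w i h'.choose else 0
  have hva : ∀ i, v i = C (a i) * X (p i) := by
    intro i
    by_cases h : i ∈ N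
    · simp only [v, p, a, dif_pos h, if_pos h, C_1, one_mul]
    · simp only [v, p, a, dif_neg h, if_neg h]
      by_cases h' : ∃ j, w i j ≠ 0
      · rw [dif_pos h', dif_pos h']
        have hj := h'.choose_spec
        rw [Finset.sum_eq_single h'.choose]
        · intro j _ hne'
          rcases huniq i h j h'.choose hne' with h0 | h0
          · rw [h0, C_0, zero_mul]
          · exact absurd h0 hj
        · intro habs; exact absurd (Finset.mem_univ _) habs
      · rw [dif_neg h', dif_neg h', C_0, zero_mul]
        push Not at h'
        exact Finset.sum_eq_zero fun j _ => by rw [h' j, C_0, zero_mul]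
  have hv_eq : v = fun i => C (a i) * X (p i) := funext hva
  refine ⟨N, p, a, hcardN, fun j => ⟨?_, ?_⟩, c, hc0, ?_⟩
  · simp only [p, dif_pos j.2]
  · simp only [a, if_pos j.2]
  · rw [hc, hv_eq]


/-! ## Step E — the linear-cycle polynomials and the periods of `ℓ` over adapted linear cycles -/

section Periods

/-- **The polynomial of a linear cycle of the Fermat variety** (Villaflor (5.2) with the rational constant `c_δ`
dropped): for a pairing `θ : τ ⊕ τ ≃ {0, …, m−1}` of the coordinates and twists `c_j` (`c_j^d = −1`), the cycle
`ℙ^{n/2} = {x_{θ(j)} = c_j x_{θ(j')}}` has `P_δ/c_δ = (∏_j c_j) · ∏_j (x_{θ j}^{d−1} − (c_j x_{θ j'})^{d−1})/(x_{θ j} − c_j x_{θ j'})`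
— for `c_j = ζ_{2d}^{α_j}` this is the printed `ζ_{2d}^{α_0+α_2+⋯+α_n} ∏_j (…)`; the product is the tree's
`HodgeTheory.fermatLinearCyclePolynomial` transported along `θ`. [cite: Villaflorloyola2021, Proposition 5.2]
[cite: DuqueFrancoVillaflor2025Join, Remark 7.1] -/
def linearCyclePoly {τ : Type*} [Fintype τ] (e : ℕ) (θ : τ ⊕ τ ≃ Fin m) (c : τ → K) :
    MvPolynomial (Fin m) K :=
  C (∏ j, c j) * rename θ (fermatLinearCyclePolynomial c e)

/-- Relabeling the pairs does not change the linear-cycle product. [cite: Villaflorloyola2021, Proposition 5.2] -/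
theorem rename_sumCongr_fermatLinearCyclePolynomial {τ τ' : Type*} [Fintype τ] [Fintype τ'] (ε : τ ≃ τ')
    (c : τ' → K) (e : ℕ) :
    rename (Equiv.sumCongr ε ε) (fermatLinearCyclePolynomial (c ∘ ε) e) = fermatLinearCyclePolynomial c e := by
  simp only [fermatLinearCyclePolynomial, fermatLinearCycleFactor, map_prod, map_sum, map_mul, map_pow, rename_X,
    rename_C, Equiv.sumCongr_apply, Sum.map_inl, Sum.map_inr, Function.comp_apply]
  exact Fintype.prod_equiv ε _ _ fun j => rfl

/-- … nor the normalised polynomial `P_δ/c_δ`. [cite: Villaflorloyola2021, Proposition 5.2] -/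
theorem linearCyclePoly_sumCongr_symm_trans {τ τ' : Type*} [Fintype τ] [Fintype τ'] (ε : τ ≃ τ') (e : ℕ)
    (θ : τ ⊕ τ ≃ Fin m) (c : τ → K) :
    linearCyclePoly e ((Equiv.sumCongr ε ε).symm.trans θ) (c ∘ ε.symm) = linearCyclePoly e θ c := by
  rw [linearCyclePoly, linearCyclePoly, Equiv.coe_trans, ← rename_rename,
    show (Equiv.sumCongr ε ε).symm = Equiv.sumCongr ε.symm ε.symm from rfl,
    rename_sumCongr_fermatLinearCyclePolynomial ε.symm c e]
  congr 2
  exact Fintype.prod_equiv ε.symm _ _ fun j => rfl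

/-- … nor the period functional. [cite: MovasatiVillaflor2018, Theorem 1] [cite: DuqueFrancoVillaflor2025Join, Remark 7.1] -/
theorem fermatLinearCycleFunctional_rename_sumCongr {τ τ' : Type*} [Fintype τ] [Fintype τ'] [DecidableEq τ]
    [DecidableEq τ'] (ε : τ ≃ τ') (c : τ' → K) (e : ℕ) (g : MvPolynomial (τ ⊕ τ) K) :
    fermatLinearCycleFunctional c e (rename (Equiv.sumCongr ε ε) g) = fermatLinearCycleFunctional (c ∘ ε) e g := by
  rw [fermatLinearCycleFunctional_apply, fermatLinearCycleFunctional_apply]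
  have hsub : (fermatLinearCycleSubst c).comp
      (rename (Equiv.sumCongr ε ε) : MvPolynomial (τ ⊕ τ) K →ₐ[K] MvPolynomial (τ' ⊕ τ') K) =
      (rename ε : MvPolynomial τ K →ₐ[K] MvPolynomial τ' K).comp (fermatLinearCycleSubst (c ∘ ε)) := by
    refine MvPolynomial.algHom_ext fun i => ?_
    rcases i with j | j
    · simp [fermatLinearCycleSubst_X_inl]
    · simp [fermatLinearCycleSubst_X_inr]
  have h := congrArg (fun f => f g) hsub
  simp only [AlgHom.comp_apply] at h
  rw [h]
  have hmap : Finsupp.mapDomain ε (fermatSocleExponent τ e) = fermatSocleExponent τ' e := by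
    ext j'
    rw [Finsupp.mapDomain_equiv_apply, fermatSocleExponent_apply, fermatSocleExponent_apply]
  rw [← hmap, coeff_rename_mapDomain _ ε.injective]

variable (N : Finset (Fin m))

/-- The pairing `θ_{σ'}` attached to a bijection `σ' : N ≃ Nᶜ`: `inl j ↦ σ'(j)` (outside `N`), `inr j ↦ j`.
[cite: Villaflorloyola2021, §5, proof of Theorem 1.2 (the cycles `ℙ^{n/2}_β` with `β_j = α_j` for `j ≠ i`)] -/
def pairingOfEquiv (σ' : N ≃ {i : Fin m // i ∉ N}) : N ⊕ N ≃ Fin m :=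
  (Equiv.sumCongr σ' (Equiv.refl N)).trans ((Equiv.sumComm _ _).trans (Equiv.sumCompl fun i => i ∈ N))

/-- `θ_{σ'}(inl j) = σ' j`. [cite: Villaflorloyola2021, §5, proof of Theorem 1.2] -/
@[simp] theorem pairingOfEquiv_inl (σ' : N ≃ {i : Fin m // i ∉ N}) (j : N) :
    pairingOfEquiv N σ' (Sum.inl j) = (σ' j : Fin m) := by
  simp [pairingOfEquiv]

/-- `θ_{σ'}(inr j) = j`. [cite: Villaflorloyola2021, §5, proof of Theorem 1.2] -/
@[simp] theorem pairingOfEquiv_inr (σ' : N ≃ {i : Fin m // i ∉ N}) (j : N) :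
    pairingOfEquiv N σ' (Sum.inr j) = (j : Fin m) := by
  simp [pairingOfEquiv]

/-- `∏_{j∈N} x_j^{e−1}` is the socle monomial of `K[x_N]/(x_j^e)`. [cite: IarrobinoKanev1999, Example 5.8] -/
theorem prod_X_pow_eq_monomial_fermatSocleExponent {τ : Type*} [Fintype τ] (e : ℕ) :
    ∏ j : τ, (X j : MvPolynomial τ K) ^ (e - 1) = monomial (fermatSocleExponent τ e) 1 := by
  rw [monomial_eq, C_1, one_mul, Finsupp.prod_fintype _ _ fun _ => pow_zero _]
  simp

variable {N} (p : Fin m → N) (a : Fin m → K) (e : ℕ)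

/-- **The periods of `ℓ = c·coeff_{x_N^{e−1}}∘(x_i ↦ a_i x_{p(i)})` over linear cycles adapted to `p`.** Let
`σ' : N ≃ Nᶜ` be a bijection with `p(σ'(j)) = j` whenever `j` is in the image of `p|_{Nᶜ}`. Then the socle coefficient
of the restriction of `∏_j (x_{σ'j}^e − (c_j x_j)^e)/(x_{σ'j} − c_j x_j)` is
`∏_{j : p(σ'j) = j} (Σ_{l<e} a_{σ'j}^l c_j^{e−1−l}) · ∏_{j : p(σ'j) ≠ j} c_j^{e−1}` — for a bijective partner map this is
Villaflor's `c_α/(c_λ c_δ ζ^{Σα}) = ∏_j (a_{2j−2}^{d−1} − (ζ^{α_{2j−2}})^{d−1})/(a_{2j−2} − ζ^{α_{2j−2}})`. Proof: the adapted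
factors restrict to `(Σ_l a^l c^{e−1−l}) x_j^{e−1}` exactly; the others to `c_j^{e−1} x_j^{e−1}` modulo `(x_i : i adapted)`,
and that error dies against the `x_i^{e−1}` already present. [cite: Villaflorloyola2021, §5, proof of Theorem 1.2] -/
theorem fermatSocleFunctional_aeval_rename_fermatLinearCyclePolynomial (hpN : ∀ j : N, p j = j)
    (haN : ∀ j : N, a j = 1) (he : 1 ≤ e) (σ' : N ≃ {i : Fin m // i ∉ N})
    (hadapt : ∀ j : N, (∃ i : Fin m, i ∉ N ∧ p i = j) → p (σ' j) = j) (c : N → K) :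
    fermatSocleFunctional K N e
        (aeval (fun i => C (a i) * X (p i)) (rename (pairingOfEquiv N σ') (fermatLinearCyclePolynomial c e))) =
      ∏ j, (if p (σ' j) = j then pairSum e (a (σ' j)) (c j) else c j ^ (e - 1)) := by
  classical
  -- the restricted factors
  set ψ : MvPolynomial (Fin m) K →ₐ[K] MvPolynomial N K := aeval (fun i => C (a i) * X (p i)) with hψ
  set F : N → MvPolynomial N K :=
    fun j => ψ (rename (pairingOfEquiv N σ') (fermatLinearCycleFactor c e j)) with hFdef
  have hF : ∀ j, F j = ∑ l ∈ Finset.range e,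
      (C (a (σ' j)) * X (p (σ' j))) ^ l * (C (c j) * X j) ^ (e - 1 - l) := by
    intro j
    simp only [hFdef, hψ, fermatLinearCycleFactor, map_sum, map_mul, map_pow, rename_X, rename_C,
      pairingOfEquiv_inl, pairingOfEquiv_inr, aeval_X, aeval_C, algebraMap_eq, hpN, haN, C_1, one_mul]
  set r : N → K := fun j => if p (σ' j) = j then pairSum e (a (σ' j)) (c j) else c j ^ (e - 1) with hr
  set M : N → MvPolynomial N K := fun j => C (r j) * X j ^ (e - 1) with hM
  -- adapted ("good") factors restrict exactly
  have hgood : ∀ j, p (σ' j) = j → F j = M j := by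
    intro j hj
    simp only [hM, hr, if_pos hj]
    rw [hF, hj, pairSum, map_sum, Finset.sum_mul]
    refine Finset.sum_congr rfl fun l hl => ?_
    rw [Finset.mem_range] at hl
    have hX : (X j : MvPolynomial N K) ^ l * X j ^ (e - 1 - l) = X j ^ (e - 1) := by
      rw [← pow_add, show l + (e - 1 - l) = e - 1 by omega]
    rw [mul_pow, mul_pow, ← map_pow, ← map_pow, map_mul]
    linear_combination (C (a (σ' j) ^ l) * C (c j ^ (e - 1 - l)) : MvPolynomial N K) * hX
  -- the ideal of the adapted coordinates; every partner coordinate lies in it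
  set 𝔞 : Ideal (MvPolynomial N K) :=
    Ideal.span (Set.range fun j : {j : N // p (σ' j) = j} => (X (j.1) : MvPolynomial N K)) with h𝔞
  have hXmem : ∀ i : Fin m, i ∉ N → (X (p i) : MvPolynomial N K) ∈ 𝔞 := fun i hi =>
    Ideal.subset_span ⟨⟨p i, hadapt (p i) ⟨i, hi, rfl⟩⟩, rfl⟩
  -- every factor is `c_j^{e−1} x_j^{e−1}` modulo `𝔞`
  have hcong : ∀ j, F j - C (c j ^ (e - 1)) * X j ^ (e - 1) ∈ 𝔞 := by
    intro j
    rw [hF, ← Finset.add_sum_erase _ _ (Finset.mem_range.mpr (by omega : 0 < e)), pow_zero, one_mul,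
      Nat.sub_zero, mul_pow, ← map_pow, add_sub_cancel_left]
    refine Ideal.sum_mem _ fun l hl => ?_
    rw [Finset.mem_erase] at hl
    have h1 : (C (a (σ' j)) * X (p (σ' j)) : MvPolynomial N K) ^ l ∈ 𝔞 :=
      Ideal.pow_mem_of_mem 𝔞 (Ideal.mul_mem_left _ _ (hXmem _ (σ' j).2)) l (Nat.pos_of_ne_zero hl.1)
    exact Ideal.mul_mem_right _ _ h1
  -- split the products into adapted and free parts
  set G : Finset N := Finset.univ.filter fun j => p (σ' j) = j with hG
  set B : Finset N := Finset.univ.filter fun j => ¬ p (σ' j) = j with hB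
  have hsplitF : ∏ j, F j = (∏ j ∈ G, F j) * ∏ j ∈ B, F j :=
    (Finset.prod_filter_mul_prod_filter_not _ _ _).symm
  have hsplitM : ∏ j, M j = (∏ j ∈ G, M j) * ∏ j ∈ B, M j :=
    (Finset.prod_filter_mul_prod_filter_not _ _ _).symm
  have hGeq : ∏ j ∈ G, F j = ∏ j ∈ G, M j :=
    Finset.prod_congr rfl fun j hj => hgood j (Finset.mem_filter.mp hj).2
  have hBcong : (∏ j ∈ B, F j) - ∏ j ∈ B, M j ∈ 𝔞 := by
    rw [← Ideal.Quotient.eq, map_prod, map_prod]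
    refine Finset.prod_congr rfl fun j hj => ?_
    have hj' : ¬ p (σ' j) = j := (Finset.mem_filter.mp hj).2
    rw [Ideal.Quotient.eq, show M j = C (c j ^ (e - 1)) * X j ^ (e - 1) by simp only [hM, hr, if_neg hj']]
    exact hcong j
  -- the adapted part absorbs `𝔞` into `(x_j^e)`
  have hcolon : ∀ q ∈ 𝔞,
      (∏ j ∈ G, M j) * q ∈ Ideal.span (Set.range fun j : N => (X j : MvPolynomial N K) ^ e) := by
    intro q hq
    have hle : 𝔞 ≤ (Ideal.span (Set.range fun j : N => (X j : MvPolynomial N K) ^ e)).colon {∏ j ∈ G, M j} := by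
      refine Ideal.span_le.mpr ?_
      rintro _ ⟨⟨i, hi⟩, rfl⟩
      rw [SetLike.mem_coe, Submodule.mem_colon_singleton, smul_eq_mul]
      have hiG : i ∈ G := Finset.mem_filter.mpr ⟨Finset.mem_univ _, hi⟩
      rw [← Finset.mul_prod_erase G M hiG, ← mul_assoc]
      have hXM : (X i : MvPolynomial N K) * M i = C (r i) * X i ^ e := by
        have : (X i : MvPolynomial N K) ^ e = X i * X i ^ (e - 1) := by
          rw [← pow_succ', Nat.sub_add_cancel he]
        simp only [hM]
        rw [this]; ring
      rw [hXM]
      exact Ideal.mul_mem_right _ _ (Ideal.mul_mem_left _ _ (Ideal.subset_span ⟨i, rfl⟩))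
    have h := hle hq
    rw [Submodule.mem_colon_singleton, smul_eq_mul] at h
    rwa [mul_comm] at h
  -- assemble
  have hprodM : ∏ j, M j = C (∏ j, r j) * monomial (fermatSocleExponent N e) 1 := by
    simp only [hM]
    rw [Finset.prod_mul_distrib, ← map_prod, prod_X_pow_eq_monomial_fermatSocleExponent]
  have hP : ψ (rename (pairingOfEquiv N σ') (fermatLinearCyclePolynomial c e)) = ∏ j, F j := by
    simp only [hFdef, fermatLinearCyclePolynomial, map_prod]
  have hdiff : ψ (rename (pairingOfEquiv N σ') (fermatLinearCyclePolynomial c e)) -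
      C (∏ j, r j) * monomial (fermatSocleExponent N e) 1 ∈
        Ideal.span (Set.range fun j : N => (X j : MvPolynomial N K) ^ e) := by
    rw [hP, ← hprodM, hsplitF, hsplitM, hGeq, ← mul_sub]
    exact hcolon _ hBcong
  have h1 := fermatSocleFunctional_eq_zero_of_mem (K := K) he hdiff
  rw [map_sub, sub_eq_zero] at h1
  rw [h1, fermatSocleFunctional_apply, C_mul_monomial, mul_one, coeff_monomial, if_pos rfl]

/-- The same with the prefactor `∏ c_j` and a scalar: the period `ℓ(P_δ/c_δ)` of
`ℓ = c₁·coeff_{x_N^{e−1}}∘(x_i ↦ a_i x_{p i})` over the adapted linear cycle `δ = (θ_{σ'}, c)` is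
`c₁ · ∏_j c_j·r_j(c_j)`, `r_j = Σ_l a_{σ'j}^l c_j^{e−1−l}` (adapted) or `c_j^{e−1}` (free).
[cite: Villaflorloyola2021, §5, proof of Theorem 1.2 (the numbers `c_α`)] -/
theorem smul_substFunctional_linearCyclePoly (hpN : ∀ j : N, p j = j) (haN : ∀ j : N, a j = 1) (he : 1 ≤ e)
    (σ' : N ≃ {i : Fin m // i ∉ N}) (hadapt : ∀ j : N, (∃ i : Fin m, i ∉ N ∧ p i = j) → p (σ' j) = j)
    (c₁ : K) (c : N → K) :
    (c₁ • substFunctional N (fun i => C (a i) * X (p i)) e) (linearCyclePoly e (pairingOfEquiv N σ') c) =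
      c₁ * ∏ j, (c j * if p (σ' j) = j then pairSum e (a (σ' j)) (c j) else c j ^ (e - 1)) := by
  rw [LinearMap.smul_apply, linearCyclePoly, substFunctional_apply, map_mul, aeval_C, algebraMap_eq,
    coeff_C_mul, ← fermatSocleFunctional_apply,
    fermatSocleFunctional_aeval_rename_fermatLinearCyclePolynomial p a e hpN haN he σ' hadapt c, smul_eq_mul,
    Finset.prod_mul_distrib]

end Periods

/-! ## Theorem 1.2 — rational periods force a genuine linear cycle -/

section Main

/-- For every `a` there is a `d`-th root `x` of `−1` with `x·Σ_{l<d−1} a^l x^{d−2−l} ≠ 0` (`d ≥ 2`, `ζ` a primitive `2d`-th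
root of unity): `ζ` or `ζ³` works, since a common zero would give `a^{d−1} = ζ^{d−1} = ζ^{3(d−1)}`. This is the choice
"fix the values of `α_j` for `j ≠ i` in such a way that `(a_j^{d−1} − (ζ^{α_j})^{d−1})/(a_j − ζ^{α_j}) ≠ 0`" of the printed
proof. [cite: Villaflorloyola2021, §5, proof of Theorem 1.2] -/
theorem exists_pairPeriod_ne_zero [CharZero K] {d : ℕ} (hd : 2 ≤ d) {ζ : K} (hζ : IsPrimitiveRoot ζ (2 * d))
    (a : K) : ∃ x : K, x ^ d = -1 ∧ pairPeriod d a x ≠ 0 := by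
  have hζd := pow_eq_neg_one_of_isPrimitiveRoot_two_mul (by omega) hζ
  have hζ0 : ζ ≠ 0 := hζ.ne_zero (by omega)
  have hμ3 : (ζ ^ 3) ^ d = -1 := by
    rw [← pow_mul, mul_comm, pow_mul, hζd]; norm_num
  by_cases h1 : pairSum (d - 1) a ζ = 0
  · by_cases h3 : pairSum (d - 1) a (ζ ^ 3) = 0
    · exfalso
      have e1 := pairSum_mul_sub (d - 1) a ζ
      rw [h1, zero_mul] at e1
      have e3 := pairSum_mul_sub (d - 1) a (ζ ^ 3)
      rw [h3, zero_mul, ← pow_mul] at e3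
      have hz : ζ ^ (d - 1) ≠ 0 := pow_ne_zero _ hζ0
      have h2 : ζ ^ (2 * (d - 1)) = 1 := by
        have h4 : ζ ^ (d - 1) * ζ ^ (2 * (d - 1)) = ζ ^ (d - 1) * 1 := by
          rw [mul_one, ← pow_add, show d - 1 + 2 * (d - 1) = 3 * (d - 1) by ring]
          linear_combination e3 - e1
        exact mul_left_cancel₀ hz h4
      have hdvd := Nat.le_of_dvd (by omega) (hζ.dvd_of_pow_eq_one _ h2)
      omega
    · exact ⟨ζ ^ 3, hμ3, mul_ne_zero (pow_ne_zero _ hζ0) h3⟩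
  · exact ⟨ζ, hζd, mul_ne_zero hζ0 h1⟩

/-- A primitive `d`-th root of unity with `d ≥ 3` is not rational: `w = q ∈ ℚ` gives `q^d = 1`, so `|q| = 1`,
`q = ±1`, `w² = 1` and `d ∣ 2`. [folklore] -/
private theorem ratCast_ne_of_isPrimitiveRoot [CharZero K] {w : K} {d : ℕ} (hd : 3 ≤ d)
    (hw : IsPrimitiveRoot w d) (q : ℚ) : w ≠ (q : K) := by
  intro h
  have hq : ((q ^ d : ℚ) : K) = ((1 : ℚ) : K) := by rw [Rat.cast_pow, ← h, hw.pow_eq_one, Rat.cast_one]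
  have hq1 : q ^ d = 1 := Rat.cast_injective hq
  have habs : |q| = 1 := by
    have h' : |q| ^ d = 1 := by rw [← abs_pow, hq1, abs_one]
    exact (pow_eq_one_iff_of_nonneg (abs_nonneg q) (by omega)).mp h'
  have hsq : q ^ 2 = 1 := by rw [← sq_abs, habs, one_pow]
  have hw2 : w ^ 2 = 1 := by rw [h, ← Rat.cast_pow, hsq, Rat.cast_one]
  have := Nat.le_of_dvd (by norm_num) (hw.dvd_of_pow_eq_one 2 hw2)
  omega

/-- **The fake-linear-cycle shape (`d ≥ 3`).** Let `d ≥ 3`, `ζ ∈ K` a primitive `2d`-th root of unity,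
`m = 2k + 2` (`n = 2k`), and let `ℓ ≠ 0` be a functional on `K[x_0, …, x_{m−1}]` killing the monomials of
`J^F = (x_i^{d−1})`, concentrated in degree `σ = (k+1)(d−2)`, with (i) `dim (Ann ℓ)_1 ≥ k + 1` and (ii) **(H2)**: for some
`c₀` every period `ℓ(P_δ/c_δ)` over a linear cycle `δ = (θ, c)` of the Fermat variety (`c_j^d = −1`) is a rational
multiple of `c₀`. Then `ℓ = c'·ℓ_δ` (`c' ≠ 0`) for the functional `ℓ_δ = coeff_{∏ y_j^{d−2}} ∘ (x_{θ(inl j)} ↦ c_j y_j,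
x_{θ(inr j)} ↦ y_j)` of a pairing `θ` with ALL TWISTS NON-ZERO, `c_j ∈ K^×` — i.e. up to a permutation of the coordinates
`P_λ = c_λ ∏_j (x_{2j−2}^{d−1} − (c_{2j−2} x_{2j−1})^{d−1})/(x_{2j−2} − c_{2j−2} x_{2j−1})` with `c_λ, c_{2j−2} ∈ ℂ^×`,
the shape of Duque Franco–Villaflor's Lemma 4.1 ("fake linear cycles") — and moreover, for each `j`, the ratios
`c_β/c_β' = y Σ_l c_j^l y^{d−2−l} / (x Σ_l c_j^l x^{d−2−l})` of the periods in the `j`-th twist (`x, y` `d`-th roots of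
`−1`) are rational: the arithmetic condition fed to Proposition 5.4 in the printed proof of Theorem 1.2. Proof:
`exists_pairing_of_linearForms` gives `ℓ = c₁·coeff∘(x_i ↦ a_i x_{p i})`; if some coordinate of `N` is nobody's partner
(Case 1) the periods over the adapted cycles are `∝ c_{j₀}^{d−1}`, so the twists `ζ, ζ³` at `j₀` give
`ζ^{2(d−1)} = ζ_d^{−1} ∈ ℚ`, impossible for `d ≥ 3`; otherwise (Case 2, the printed case) the partner map is a perfect
matching, the periods are Villaflor's `c_α = c₁ ∏_j ζ^{α_j}(a_j^{d−1} − ζ^{α_j(d−1)})/(a_j − ζ^{α_j})`, their ratios in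
one twist are rational, and `a_j = 0` is excluded the same way as Case 1.
[cite: DuquefrancoVillaflorloyola2023, Lemma 4.1] [cite: Villaflorloyola2021, Remark 5.1 and proof of Theorem 1.2] -/
theorem exists_fakeLinearCycle_of_rational_periods [CharZero K] {k d : ℕ} (hm : m = 2 * k + 2) (hd : 3 ≤ d)
    {ζ : K} (hζ : IsPrimitiveRoot ζ (2 * d)) (ℓ : MvPolynomial (Fin m) K →ₗ[K] K)
    (hbox : ∀ s : Fin m →₀ ℕ, (∃ i, d - 1 ≤ s i) → ℓ (monomial s 1) = 0)
    (hℓ : ∀ q, ℓ (homogeneousComponent ((k + 1) * (d - 2)) q) = ℓ q) (hne : ℓ ≠ 0)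
    (hlin : k + 1 ≤ finrank K (idealDegree (annIdeal ℓ) 1))
    (hrat : ∃ c₀ : K, ∀ (θ : Fin (k + 1) ⊕ Fin (k + 1) ≃ Fin m) (c : Fin (k + 1) → K),
      (∀ j, c j ^ d = -1) → ∃ q : ℚ, ℓ (linearCyclePoly (d - 1) θ c) = (q : K) * c₀) :
    ∃ (θ : Fin (k + 1) ⊕ Fin (k + 1) ≃ Fin m) (c : Fin (k + 1) → K), (∀ j, c j ≠ 0) ∧
      (∀ j (x y : K), x ^ d = -1 → y ^ d = -1 → pairPeriod d (c j) x ≠ 0 →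
        ∃ q : ℚ, pairPeriod d (c j) y = (q : K) * pairPeriod d (c j) x) ∧
      ∃ c' : K, c' ≠ 0 ∧
        ℓ = c' • (fermatLinearCycleFunctional c (d - 1) ∘ₗ
          (rename θ.symm : MvPolynomial (Fin m) K →ₐ[K] MvPolynomial (Fin (k + 1) ⊕ Fin (k + 1)) K).toLinearMap) := by
  classical
  obtain ⟨c₀, hrat⟩ := hrat
  have he : 2 ≤ d - 1 := by omega
  have he1 : 1 ≤ d - 1 := by omega
  have hℓ' : ∀ q, ℓ (homogeneousComponent ((k + 1) * (d - 1 - 1)) q) = ℓ q := by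
    intro q; rw [show d - 1 - 1 = d - 2 by omega]; exact hℓ q
  obtain ⟨N, p, a, hN, hpa, c₁, hc₁, hℓeq⟩ := exists_pairing_of_linearForms hm he ℓ hbox hℓ' hne hlin
  -- roots of unity
  have hζd : ζ ^ d = -1 := pow_eq_neg_one_of_isPrimitiveRoot_two_mul (by omega) hζ
  have hζ0 : ζ ≠ 0 := hζ.ne_zero (by omega)
  obtain ⟨w, hw_def⟩ : ∃ w : K, w = ζ ^ 2 := ⟨_, rfl⟩
  have hw : IsPrimitiveRoot w d := hw_def ▸ isPrimitiveRoot_sq_of_isPrimitiveRoot_two_mul hζ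
  have hwd : w ^ d = 1 := hw.pow_eq_one
  have hw0 : w ≠ 0 := hw.ne_zero (by omega)
  -- cardinalities and the relabeling `ε : N ≃ Fin (k+1)`
  have hcardc : Fintype.card {i : Fin m // i ∉ N} = Fintype.card N := by
    rw [Fintype.card_subtype_compl, Fintype.card_coe, Fintype.card_fin, hN]; omega
  obtain ⟨ε⟩ : Nonempty (N ≃ Fin (k + 1)) :=
    Fintype.card_eq.mp (by rw [Fintype.card_coe, hN, Fintype.card_fin])
  -- (H2) for pairings indexed by `N`
  have hrat' : ∀ (θ : N ⊕ N ≃ Fin m) (c : N → K), (∀ j, c j ^ d = -1) →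
      ∃ q : ℚ, ℓ (linearCyclePoly (d - 1) θ c) = (q : K) * c₀ := by
    intro θ c hc
    obtain ⟨q, hq⟩ := hrat ((Equiv.sumCongr ε ε).symm.trans θ) (c ∘ ε.symm) fun j => hc _
    exact ⟨q, by rw [← hq, linearCyclePoly_sumCongr_symm_trans]⟩
  -- the periods over adapted cycles
  have hval : ∀ σ' : N ≃ {i : Fin m // i ∉ N}, (∀ j : N, (∃ i : Fin m, i ∉ N ∧ p i = j) → p (σ' j) = j) →
      ∀ c : N → K, ℓ (linearCyclePoly (d - 1) (pairingOfEquiv N σ') c) =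
        c₁ * ∏ j, (c j * if p (σ' j) = j then pairSum (d - 1) (a (σ' j)) (c j) else c j ^ (d - 1 - 1)) := by
    intro σ' had c
    rw [hℓeq]
    exact smul_substFunctional_linearCyclePoly p a (d - 1) (fun j => (hpa j).1) (fun j => (hpa j).2) he1 σ' had c₁ c
  -- good twists for every coordinate
  have hG : ∀ b : K, ∃ x : K, x ^ d = -1 ∧ pairPeriod d b x ≠ 0 := fun b => exists_pairPeriod_ne_zero (by omega) hζ b
  choose g hg using hG
  have hζ3 : (ζ ^ 3) ^ d = -1 := by rw [← pow_mul, mul_comm, pow_mul, hζd]; norm_num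
  -- `ζ^{2(d−1)} = w^{d−1} = w⁻¹` is irrational (`d ≥ 3`)
  have hwinv : w⁻¹ = ζ ^ (2 * (d - 1)) := by
    have h1 : w ^ (d - 1) * w = 1 := by rw [← pow_succ, Nat.sub_add_cancel (by omega : 1 ≤ d), hwd]
    rw [hw_def, ← pow_mul] at h1
    rw [hw_def]
    exact (eq_inv_of_mul_eq_one_left h1).symm
  have hpow3 : (ζ ^ 3) ^ (d - 1) = ζ ^ (2 * (d - 1)) * ζ ^ (d - 1) := by
    rw [← pow_mul, ← pow_add]; ring_nf
  have hwrat : ∀ q : ℚ, w⁻¹ ≠ (q : K) := fun q => ratCast_ne_of_isPrimitiveRoot hd hw.inv q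
  by_cases hsurj : ∀ j : N, ∃ i : Fin m, i ∉ N ∧ p i = j
  · /- Case 2 (the printed case): the partner map is a perfect matching `N ≃ Nᶜ`. -/
    let pr : {i : Fin m // i ∉ N} → N := fun i => p i
    have hprs : Function.Surjective pr := fun j => by
      obtain ⟨i, hi, h⟩ := hsurj j; exact ⟨⟨i, hi⟩, h⟩
    have hprb : Function.Bijective pr := (Fintype.bijective_iff_surjective_and_card pr).mpr ⟨hprs, hcardc⟩
    let σ' : N ≃ {i : Fin m // i ∉ N} := (Equiv.ofBijective pr hprb).symm
    have hσ' : ∀ j, p (σ' j) = j := fun j => Equiv.ofBijective_apply_symm_apply pr hprb j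
    have hval2 : ∀ c : N → K, ℓ (linearCyclePoly (d - 1) (pairingOfEquiv N σ') c) =
        c₁ * ∏ j, pairPeriod d (a (σ' j)) (c j) := by
      intro c
      rw [hval σ' (fun j _ => hσ' j) c]
      simp only [hσ', if_true, pairPeriod]
    -- the ratios of the periods in one twist are rational (`c_β/c_β' ∈ ℚ` of the printed proof)
    have hratio : ∀ (j₀ : N) (x y : K), x ^ d = -1 → y ^ d = -1 → pairPeriod d (a (σ' j₀)) x ≠ 0 →
        ∃ q : ℚ, pairPeriod d (a (σ' j₀)) y = (q : K) * pairPeriod d (a (σ' j₀)) x := by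
      intro j₀ x y hx hy hTx
      let cx : N → K := Function.update (fun j => g (a (σ' j))) j₀ x
      let cy : N → K := Function.update (fun j => g (a (σ' j))) j₀ y
      have hcx : ∀ j, cx j ^ d = -1 := fun j => by
        by_cases h : j = j₀
        · subst h; simp [cx, hx]
        · simp only [cx, Function.update_of_ne h]; exact (hg _).1
      have hcy : ∀ j, cy j ^ d = -1 := fun j => by
        by_cases h : j = j₀
        · subst h; simp [cy, hy]
        · simp only [cy, Function.update_of_ne h]; exact (hg _).1
      set D : K := ∏ j ∈ Finset.univ.erase j₀, pairPeriod d (a (σ' j)) (g (a (σ' j))) with hD_def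
      have hD : D ≠ 0 := Finset.prod_ne_zero_iff.mpr fun j _ => (hg _).2
      have hprod : ∀ (z : K) (cz : N → K), cz = Function.update (fun j => g (a (σ' j))) j₀ z →
          ∏ j, pairPeriod d (a (σ' j)) (cz j) = pairPeriod d (a (σ' j₀)) z * D := by
        intro z cz hcz
        rw [← Finset.mul_prod_erase _ _ (Finset.mem_univ j₀), hcz, Function.update_self]
        congr 1
        exact Finset.prod_congr rfl fun j hj => by rw [Function.update_of_ne (Finset.mem_erase.mp hj).1]
      obtain ⟨qx, hqx⟩ := hrat' _ cx hcx
      obtain ⟨qy, hqy⟩ := hrat' _ cy hcy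
      rw [hval2, hprod x cx rfl] at hqx
      rw [hval2, hprod y cy rfl] at hqy
      have hx0 : (qx : K) * c₀ ≠ 0 := by rw [← hqx]; exact mul_ne_zero hc₁ (mul_ne_zero hTx hD)
      have hqx0 : (qx : K) ≠ 0 := left_ne_zero_of_mul hx0
      have hc0 : c₀ ≠ 0 := right_ne_zero_of_mul hx0
      refine ⟨qy / qx, ?_⟩
      have key : (pairPeriod d (a (σ' j₀)) y * qx - qy * pairPeriod d (a (σ' j₀)) x) * c₀ = 0 := by
        linear_combination (-(pairPeriod d (a (σ' j₀)) y)) * hqx + (pairPeriod d (a (σ' j₀)) x) * hqy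
      have key' := (mul_eq_zero.mp key).resolve_right hc0
      rw [Rat.cast_div, div_mul_eq_mul_div, eq_div_iff hqx0]
      linear_combination key'
    -- no twist vanishes: `a = 0` would make the ratio `ζ^{3(d−1)}/ζ^{d−1} = ζ_d^{−1}` rational
    have ha0 : ∀ j₀ : N, a (σ' j₀) ≠ 0 := by
      intro j₀ h0
      have hP : ∀ x : K, pairPeriod d (a (σ' j₀)) x = x ^ (d - 1) := fun x => by
        rw [h0, pairPeriod, pairSum_zero_left he1, ← pow_succ', show d - 1 - 1 + 1 = d - 1 by omega]
      obtain ⟨q, hq⟩ := hratio j₀ ζ (ζ ^ 3) hζd hζ3 (by rw [hP]; exact pow_ne_zero _ hζ0)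
      rw [hP, hP, hpow3] at hq
      have hq' : ζ ^ (2 * (d - 1)) = (q : K) := mul_right_cancel₀ (pow_ne_zero _ hζ0) hq
      exact hwrat q (by rw [hwinv, hq'])
    -- the (fake) linear cycle: pairs `(σ' j, j)`, twists `a (σ' j)`
    set θ : N ⊕ N ≃ Fin m := pairingOfEquiv N σ' with hθ
    have hident : ∀ g' : MvPolynomial (Fin m) K,
        substFunctional N (fun i => C (a i) * X (p i)) (d - 1) g' =
          fermatLinearCycleFunctional (fun j => a (σ' j)) (d - 1) (rename θ.symm g') := by
      intro g'
      rw [substFunctional_apply, fermatLinearCycleFunctional_apply]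
      congr 1
      have halg : (aeval (fun i => C (a i) * X (p i)) : MvPolynomial (Fin m) K →ₐ[K] MvPolynomial N K) =
          (fermatLinearCycleSubst fun j => a (σ' j)).comp
            (rename θ.symm : MvPolynomial (Fin m) K →ₐ[K] MvPolynomial (N ⊕ N) K) := by
        refine MvPolynomial.algHom_ext fun i => ?_
        rw [aeval_X, AlgHom.comp_apply, rename_X]
        rcases hi : θ.symm i with j | j
        · have hij : i = (σ' j : Fin m) := by
            rw [← pairingOfEquiv_inl N σ' j, ← hθ, ← hi, Equiv.apply_symm_apply]
          rw [fermatLinearCycleSubst_X_inl, hij, hσ']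
        · have hij : i = (j : Fin m) := by
            rw [← pairingOfEquiv_inr N σ' j, ← hθ, ← hi, Equiv.apply_symm_apply]
          rw [fermatLinearCycleSubst_X_inr, hij, (hpa j).1, (hpa j).2, C_1, one_mul]
      exact congrArg (fun f => f g') halg
    refine ⟨(Equiv.sumCongr ε ε).symm.trans θ, fun j => a (σ' (ε.symm j)), fun j => ha0 _,
      fun j x y hx hy hTx => hratio _ x y hx hy hTx, c₁, hc₁, ?_⟩
    rw [hℓeq]
    congr 1
    refine LinearMap.ext fun g' => ?_
    have hcε : ((fun j => a (σ' (ε.symm j))) ∘ ε) = fun j => a (σ' j) := funext fun j => by simp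
    rw [hident, LinearMap.comp_apply, AlgHom.toLinearMap_apply,
      show ((Equiv.sumCongr ε ε).symm.trans θ).symm = θ.symm.trans (Equiv.sumCongr ε ε) from rfl,
      Equiv.coe_trans, ← rename_rename, fermatLinearCycleFunctional_rename_sumCongr, hcε]
  · /- Case 1: some coordinate `j₀ ∈ N` is nobody's partner. -/
    exfalso
    push Not at hsurj
    obtain ⟨j₀, hj₀⟩ := hsurj
    -- an adapted bijection `σ' : N ≃ Nᶜ` (extend a section of `p` on its image)
    let s : Finset N := Finset.univ.filter fun j => ∃ i : Fin m, i ∉ N ∧ p i = j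
    let f : N → Fin m := fun j => if h : ∃ i : Fin m, i ∉ N ∧ p i = j then h.choose else (j : Fin m)
    have hf : ∀ j : N, (∃ i : Fin m, i ∉ N ∧ p i = j) → f j ∉ N ∧ p (f j) = j := fun j h => by
      simp only [f, dif_pos h]; exact h.choose_spec
    let t : Finset (Fin m) := Finset.univ.filter fun i => i ∉ N
    have ht : t = Nᶜ := by ext i; simp [t]
    have hαt : Fintype.card N = t.card := by
      rw [ht, Finset.card_compl, Fintype.card_fin, Fintype.card_coe, hN]; omega
    have hfst : Finset.image f s ⊆ t := by
      intro i hi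
      rw [Finset.mem_image] at hi
      obtain ⟨j, hj, rfl⟩ := hi
      simp only [t, Finset.mem_filter, Finset.mem_univ, true_and]
      exact (hf j (Finset.mem_filter.mp hj).2).1
    have hfs : Set.InjOn f s := by
      intro j hj j' hj' hjj'
      have h1 := (hf j (Finset.mem_filter.mp hj).2).2
      have h2 := (hf j' (Finset.mem_filter.mp hj').2).2
      calc j = p (f j) := h1.symm
        _ = p (f j') := by rw [hjj']
        _ = j' := h2
    obtain ⟨gσ, hgσ⟩ := Finset.exists_equiv_extend_of_card_eq hαt hfst hfs
    let tEquiv : t ≃ {i : Fin m // i ∉ N} := Equiv.subtypeEquivRight fun i => by simp [t]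
    let σ' : N ≃ {i : Fin m // i ∉ N} := gσ.trans tEquiv
    have had : ∀ j : N, (∃ i : Fin m, i ∉ N ∧ p i = j) → p (σ' j) = j := by
      intro j hj
      have hjs : j ∈ s := Finset.mem_filter.mpr ⟨Finset.mem_univ _, hj⟩
      have hv : ((σ' j : {i : Fin m // i ∉ N}) : Fin m) = f j := hgσ j hjs
      have : (σ' j : {i : Fin m // i ∉ N}) = ⟨f j, (hf j hj).1⟩ := Subtype.ext hv
      rw [this]
      exact (hf j hj).2
    have hbad : ¬ p (σ' j₀) = j₀ := hj₀ _ (σ' j₀).2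
    -- the two cycles: good twists everywhere, `ζ` resp. `ζ³` at `j₀`
    let base : N → K := fun j => g (a (σ' j))
    let c1 : N → K := Function.update base j₀ ζ
    let c3 : N → K := Function.update base j₀ (ζ ^ 3)
    have hc1 : ∀ j, c1 j ^ d = -1 := fun j => by
      by_cases h : j = j₀
      · subst h; simp [c1, hζd]
      · simp only [c1, Function.update_of_ne h]; exact (hg _).1
    have hc3 : ∀ j, c3 j ^ d = -1 := fun j => by
      by_cases h : j = j₀
      · subst h; simp [c3, hζ3]
      · simp only [c3, Function.update_of_ne h]; exact (hg _).1
    -- the common factor `D` of the two periods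
    set R : N → K → K := fun j x =>
      x * if p (σ' j) = j then pairSum (d - 1) (a (σ' j)) x else x ^ (d - 1 - 1) with hR
    set D : K := ∏ j ∈ Finset.univ.erase j₀, R j (base j) with hD_def
    have hD : D ≠ 0 := by
      refine Finset.prod_ne_zero_iff.mpr fun j _ => ?_
      have hbj : base j ^ d = -1 := (hg _).1
      have hb0 : base j ≠ 0 := fun h0 => by rw [h0, zero_pow (by omega)] at hbj; norm_num at hbj
      simp only [hR]
      split_ifs with hj
      · exact (hg (a (σ' j))).2
      · exact mul_ne_zero hb0 (pow_ne_zero _ hb0)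
    have hprod : ∀ (z : K) (cz : N → K), cz = Function.update base j₀ z →
        ∏ j, (cz j * if p (σ' j) = j then pairSum (d - 1) (a (σ' j)) (cz j) else cz j ^ (d - 1 - 1)) =
          z ^ (d - 1) * D := by
      intro z cz hcz
      rw [show (∏ j, (cz j * if p (σ' j) = j then pairSum (d - 1) (a (σ' j)) (cz j) else cz j ^ (d - 1 - 1))) =
          ∏ j, R j (cz j) from rfl, ← Finset.mul_prod_erase _ _ (Finset.mem_univ j₀), hcz, Function.update_self]
      congr 1
      · simp only [hR, if_neg hbad]
        rw [← pow_succ', show d - 1 - 1 + 1 = d - 1 by omega]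
      · exact Finset.prod_congr rfl fun j hj => by rw [Function.update_of_ne (Finset.mem_erase.mp hj).1]
    obtain ⟨q1, hq1⟩ := hrat' _ c1 hc1
    obtain ⟨q3, hq3⟩ := hrat' _ c3 hc3
    rw [hval σ' had, hprod ζ c1 rfl] at hq1
    rw [hval σ' had, hprod (ζ ^ 3) c3 rfl] at hq3
    -- `c₁ ζ^{d−1} D = q₁ c₀ ≠ 0`, `c₁ ζ^{3(d−1)} D = q₃ c₀`
    have h10 : (q1 : K) * c₀ ≠ 0 := by
      rw [← hq1]; exact mul_ne_zero hc₁ (mul_ne_zero (pow_ne_zero _ hζ0) hD)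
    have hq10 : (q1 : K) ≠ 0 := left_ne_zero_of_mul h10
    have hc0 : c₀ ≠ 0 := right_ne_zero_of_mul h10
    -- so `ζ^{2(d−1)} = w⁻¹` would be rational
    have key : (ζ ^ (2 * (d - 1)) * q1 - q3) * (c₁ * ζ ^ (d - 1) * D) = 0 := by
      rw [hpow3] at hq3
      linear_combination (q1 : K) * hq3 - (q3 : K) * hq1 + (ζ ^ (2 * (d - 1)) * ↑q1 - ↑q3) * (0 : K) * hq1
    have hnz : c₁ * ζ ^ (d - 1) * D ≠ 0 := mul_ne_zero (mul_ne_zero hc₁ (pow_ne_zero _ hζ0)) hD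
    have key' := (mul_eq_zero.mp key).resolve_right hnz
    have hwq : w⁻¹ = ((q3 / q1 : ℚ) : K) := by
      rw [hwinv, Rat.cast_div, eq_div_iff hq10]
      linear_combination key'
    exact hwrat (q3 / q1) hwq

/-- **Villaflor, Theorem 1.2 at the level of the period functional.** Let `d ≥ 5`, `d ≠ 6` (the content of
`ζ_d + ζ_d^{−1} ∉ ℚ` for `d ≥ 3`), `ζ ∈ K` a primitive `2d`-th root of unity, `m = 2k + 2` (`n = 2k`). Let `ℓ ≠ 0` be a
functional on `K[x_0, …, x_{m−1}]` killing the monomials of `J^F = (x_i^{d−1})`, concentrated in degree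
`σ = (k+1)(d−2)` (a period vector on Movasati's box; `Ann ℓ = J^{F,λ}`), such that
(i) `dim (Ann ℓ)_1 ≥ k + 1` ("there exist `L_1, …, L_{n/2+1} ∈ J^{F,λ}_1` linearly independent") and
(ii) **(H2)** for some `c₀` every period `ℓ(P_δ/c_δ)` over a linear cycle `δ = (θ, c)` of the Fermat variety
(`c_j^d = −1`) is a rational multiple of `c₀` (Prop. 5.1 for a rational Hodge cycle `λ`, with Prop. 5.2's `P_δ`).
Then `ℓ = c'·ℓ_δ` for the period functional `ℓ_δ` (tree `HodgeTheory.fermatLinearCycleFunctional`, transported along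
`θ`) of a GENUINE linear cycle `δ = {x_{θ j} = c_j x_{θ j'}} ⊆ X` (`c_j^d = −1`): the linear forms of `J^{F,λ}` cut out
`ℙ^{n/2} ⊆ X` and (Prop. 4.2, Cor. 2.3) `λ_prim = c·[ℙ^{n/2}]_prim`. Proof: by
`exists_fakeLinearCycle_of_rational_periods` (valid for `d ≥ 3`) `ℓ = c'·ℓ_δ` for a pairing with non-zero twists
`c_j` whose period ratios in each twist are rational, and Proposition 5.4 (`pow_eq_neg_one_of_forall_ratio_rational`,
`d ≠ 1, 2, 3, 4, 6`) gives `c_j^d = −1`. [cite: Villaflorloyola2021, Theorem 1.2, Proposition 4.2, Remark 5.1] -/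
theorem exists_linearCycle_of_rational_periods [CharZero K] {k d : ℕ} (hm : m = 2 * k + 2) (hd : 5 ≤ d)
    (hd6 : d ≠ 6) {ζ : K} (hζ : IsPrimitiveRoot ζ (2 * d)) (ℓ : MvPolynomial (Fin m) K →ₗ[K] K)
    (hbox : ∀ s : Fin m →₀ ℕ, (∃ i, d - 1 ≤ s i) → ℓ (monomial s 1) = 0)
    (hℓ : ∀ q, ℓ (homogeneousComponent ((k + 1) * (d - 2)) q) = ℓ q) (hne : ℓ ≠ 0)
    (hlin : k + 1 ≤ finrank K (idealDegree (annIdeal ℓ) 1))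
    (hrat : ∃ c₀ : K, ∀ (θ : Fin (k + 1) ⊕ Fin (k + 1) ≃ Fin m) (c : Fin (k + 1) → K),
      (∀ j, c j ^ d = -1) → ∃ q : ℚ, ℓ (linearCyclePoly (d - 1) θ c) = (q : K) * c₀) :
    ∃ (θ : Fin (k + 1) ⊕ Fin (k + 1) ≃ Fin m) (c : Fin (k + 1) → K), (∀ j, c j ^ d = -1) ∧
      ∃ c' : K, c' ≠ 0 ∧
        ℓ = c' • (fermatLinearCycleFunctional c (d - 1) ∘ₗ
          (rename θ.symm : MvPolynomial (Fin m) K →ₐ[K] MvPolynomial (Fin (k + 1) ⊕ Fin (k + 1)) K).toLinearMap) := by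
  obtain ⟨θ, c, -, hratio, c', hc', h⟩ :=
    exists_fakeLinearCycle_of_rational_periods hm (by omega) hζ ℓ hbox hℓ hne hlin hrat
  exact ⟨θ, c, fun j => pow_eq_neg_one_of_forall_ratio_rational hd hd6 hζ (c j) (hratio j), c', hc', h⟩

end Main


/-! ## Theorem 1.1 — the rank form (Movasati's period matrix) -/

section RankForm

open Movasati2016

/-- The degree bookkeeping `d + ((n/2)d − n − 2) = (n/2+1)(d−2)` for `n = 2k`, `2k + 2 ≤ k d`. [cite: Movasati2016Periods, Definition 1] -/
private theorem col_add_row_eq {k d : ℕ} (hk : 2 * k + 2 ≤ k * d) : d + (k * d - 2 * k - 2) = (k + 1) * (d - 2) := by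
  have hd : 2 ≤ d := by
    by_contra h
    push Not at h
    interval_cases d <;> omega
  zify [hd, hk, (by omega : 2 * k ≤ k * d), (by omega : 2 ≤ k * d - 2 * k)]
  ring

/-- **Villaflor, Theorem 1.1 at the level of the period matrix** (the "only if": "`codim_{T_0T} T_0V_λ =
C(n/2+d, d) − (n/2+1)²` … only if `λ(0)_prim = a[ℙ^{n/2}]_prim`"), `m = 2k + 2` variables (`n = 2k`), `d ≥ 2 + 6/n`
(`d + 1 ≤ (k+1)(d−2)`, Remark 4.1), `d ∉ {3,4,6}`: if the period functional `ℓ ≠ 0` of a class (killing `J^F`,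
concentrated in degree `σ`) has Movasati's matrix `[p_{i+j}]` (rows `I_{kd−2k−2}`, columns `I_d`; tree
`Movasati2016.periodMatrix`, its kernel being `T_0V_λ` by [Movasati2016Periods] Thm. 6) of rank EXACTLY
`C(k+d, d) − (k+1)²`, and its periods over linear cycles satisfy (H2), then `ℓ` is a non-zero multiple of the period
functional of a linear cycle of the Fermat variety. Proof: Prop. 4.1 (tree `Movasati2017.hilbert_annIdeal_one_eq_of_hilbert_eq`,
via `Movasati2016.rank_periodMatrix_eq_hilbert`) gives the `k+1` linear forms, then `exists_linearCycle_of_rational_periods`.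
The converse ("if") is the tree's `MovasatiVillaflor2018.rank_periodMatrix_linearCycle`.
[cite: Villaflorloyola2021, Theorem 1.1, Proposition 4.1] [cite: Movasati2016Periods, Theorem 6] -/
theorem exists_linearCycle_of_rank_eq [CharZero K] {k d : ℕ} (hm : m = 2 * k + 2) (hd : 5 ≤ d) (hd6 : d ≠ 6)
    (hσ : d + 1 ≤ (k + 1) * (d - 2)) {ζ : K} (hζ : IsPrimitiveRoot ζ (2 * d))
    (ℓ : MvPolynomial (Fin m) K →ₗ[K] K)
    (hbox : ∀ s : Fin m →₀ ℕ, (∃ i, d - 1 ≤ s i) → ℓ (monomial s 1) = 0)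
    (hℓ : ∀ q, ℓ (homogeneousComponent ((k + 1) * (d - 2)) q) = ℓ q) (hne : ℓ ≠ 0)
    (hrank : (periodMatrix m d (k * d - 2 * k - 2) d (periodVector ℓ)).rank = (k + d).choose d - (k + 1) ^ 2)
    (hrat : ∃ c₀ : K, ∀ (θ : Fin (k + 1) ⊕ Fin (k + 1) ≃ Fin m) (c : Fin (k + 1) → K),
      (∀ j, c j ^ d = -1) → ∃ q : ℚ, ℓ (linearCyclePoly (d - 1) θ c) = (q : K) * c₀) :
    ∃ (θ : Fin (k + 1) ⊕ Fin (k + 1) ≃ Fin m) (c : Fin (k + 1) → K), (∀ j, c j ^ d = -1) ∧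
      ∃ c' : K, c' ≠ 0 ∧
        ℓ = c' • (fermatLinearCycleFunctional c (d - 1) ∘ₗ
          (rename θ.symm : MvPolynomial (Fin m) K →ₐ[K] MvPolynomial (Fin (k + 1) ⊕ Fin (k + 1)) K).toLinearMap) := by
  have hk : 2 * k + 2 ≤ k * d := by
    have h1 : (k + 1) * (d - 2) = k * d - 2 * k + (d - 2) := by
      zify [(by omega : 2 ≤ d), (by nlinarith : 2 * k ≤ k * d)]
      ring
    omega
  have heq : finrank K (homogeneousSubmodule (Fin m) K d) - finrank K (idealDegree (annIdeal ℓ) d) =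
      (k + d).choose d - (k + 1) ^ 2 := by
    rw [← hrank, rank_periodMatrix_eq_hilbert ℓ hbox hℓ (col_add_row_eq hk)]
  have h1 := Movasati2017.hilbert_annIdeal_one_eq_of_hilbert_eq (by omega) hσ ℓ hbox hℓ rfl hne heq
  have hS1 : finrank K (homogeneousSubmodule (Fin m) K 1) = m := finrank_homogeneousSubmodule_one
  haveI : Module.Finite K (homogeneousSubmodule (Fin m) K 1) := finite_homogeneousSubmodule 1
  have hle : finrank K (idealDegree (annIdeal ℓ) 1) ≤ finrank K (homogeneousSubmodule (Fin m) K 1) :=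
    Submodule.finrank_mono (idealDegree_le_homogeneousSubmodule _ 1)
  exact exists_linearCycle_of_rational_periods hm hd hd6 hζ ℓ hbox hℓ hne (by omega) hrat

end RankForm

/-! ## The census parametrisation: even `n`, `Fin (n+2)`, Movasati–Villaflor's `ℙ^{n/2}_{a,b}` -/

section Census

open Movasati2016

variable {n d : ℕ} {ζ : K}

/-- Villaflor's normalised `P_δ = ζ_{2d}^{Σ_e (1+2a_{2e+1})} ∏_e (x_{b(2e)}^{d−1} − (ζ^{1+2a_{2e+1}} x_{b(2e+1)})^{d−1})/(x_{b(2e)} − ζ^{1+2a_{2e+1}} x_{b(2e+1)})`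
of the linear cycle `ℙ^{n/2}_{a,b}` of [MovasatiVillaflor2018] §1 (the rational `c_δ` of Prop. 5.2 dropped).
[cite: Villaflorloyola2021, Proposition 5.2] [cite: MovasatiVillaflor2018, §1, Theorem 1] -/
def linearCyclePolyMV (n d : ℕ) (ζ : K) (a : Fin (n + 2) → ℕ) (b : Equiv.Perm (Fin (n + 2))) (hn : Even n) :
    MvPolynomial (Fin (n + 2)) K :=
  linearCyclePoly (d - 1) ((pairEquiv n hn).trans b) (twist n ζ a)

/-- Every tuple of `d`-th roots of `−1` is a twist vector `(ζ^{1+2a_{2e+1}})_e` (`ζ` a primitive `2d`-th root of unity: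
the odd powers of `ζ_{2d}` are exactly the `d`-th roots of `−1`). [cite: MovasatiVillaflor2018, §1]
[cite: Villaflorloyola2021, Proposition 5.2] -/
theorem exists_twist_eq [CharZero K] (hn : Even n) (hd : 1 ≤ d) (hζ : IsPrimitiveRoot ζ (2 * d))
    (c : Fin (n / 2 + 1) → K) (hc : ∀ j, c j ^ d = -1) : ∃ a : Fin (n + 2) → ℕ, twist n ζ a = c := by
  have hk : n = 2 * (n / 2) := by obtain ⟨r, hr⟩ := hn; omega
  haveI : NeZero (2 * d) := ⟨by omega⟩
  have hodd : ∀ j, ∃ r : ℕ, c j = ζ ^ (2 * r + 1) := by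
    intro j
    have h2d : c j ^ (2 * d) = 1 := by rw [mul_comm, pow_mul, hc]; norm_num
    obtain ⟨i, -, hi⟩ := hζ.eq_pow_of_pow_eq_one h2d
    rcases Nat.even_or_odd i with ⟨t, ht⟩ | ⟨t, ht⟩
    · exfalso
      have h1 : c j ^ d = 1 := by
        rw [← hi, ht, ← two_mul, ← pow_mul, mul_assoc, mul_comm t d, ← mul_assoc, pow_mul, hζ.pow_eq_one,
          one_pow]
      rw [hc] at h1
      have h2 : (2 : K) = 0 := by linear_combination -h1
      exact two_ne_zero h2
    · exact ⟨t, by rw [← hi, ht]⟩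
  choose r hr using hodd
  refine ⟨fun x => r ⟨x / 2, by omega⟩, funext fun j => ?_⟩
  rw [twist, hr j]
  congr 1
  have : (⟨(2 * (j : ℕ) + 1) / 2, by omega⟩ : Fin (n / 2 + 1)) = j := Fin.ext (by simp; omega)
  rw [this]
  ring

/-- **Villaflor, Theorem 1.2 in the census parametrisation.** `n` even, `d ≥ 5`, `d ≠ 6`, `ζ` a primitive `2d`-th
root of unity; `ℓ ≠ 0` a period functional on `K[x_0, …, x_{n+1}]` (kills `(x_i^{d−1})`, concentrated in degree
`(n/2+1)(d−2)`) with `n/2 + 1` independent linear forms in `Ann ℓ = J^{F,λ}` and (H2) over the linear cycles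
`ℙ^{n/2}_{a,b}` of [MovasatiVillaflor2018]: then `ℓ = c'·ℓ_{a,b}` for some linear cycle — so its period vector is
`c'·p(ℙ^{n/2}_{a,b})` (MV18 Thm. 1, tree `linearCyclePeriod`) and `J^{F,λ} = J^{F,[ℙ^{n/2}_{a,b}]} = ⟨x_{b(2e)} −
ζ^{1+2a_{2e+1}} x_{b(2e+1)}, x_i^{d−1}⟩` ("`{L_1 = ⋯ = L_{n/2+1} = 0} ⊆ X`", Remark 5.1 with `a_i^d = −1`; Prop. 4.2:
`λ_prim = c·[ℙ^{n/2}]_prim`). [cite: Villaflorloyola2021, Theorem 1.2, Proposition 4.2, Remark 5.1]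
[cite: MovasatiVillaflor2018, Theorem 1] -/
theorem exists_linearCycleFunctional_of_rational_periods [CharZero K] (hn : Even n) (hd : 5 ≤ d) (hd6 : d ≠ 6)
    (hζ : IsPrimitiveRoot ζ (2 * d)) (ℓ : MvPolynomial (Fin (n + 2)) K →ₗ[K] K)
    (hbox : ∀ s : Fin (n + 2) →₀ ℕ, (∃ i, d - 1 ≤ s i) → ℓ (monomial s 1) = 0)
    (hℓ : ∀ q, ℓ (homogeneousComponent ((n / 2 + 1) * (d - 2)) q) = ℓ q) (hne : ℓ ≠ 0)
    (hlin : n / 2 + 1 ≤ finrank K (idealDegree (annIdeal ℓ) 1))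
    (hrat : ∃ c₀ : K, ∀ (a : Fin (n + 2) → ℕ) (b : Equiv.Perm (Fin (n + 2))),
      ∃ q : ℚ, ℓ (linearCyclePolyMV n d ζ a b hn) = (q : K) * c₀) :
    ∃ (a : Fin (n + 2) → ℕ) (b : Equiv.Perm (Fin (n + 2))) (c' : K), c' ≠ 0 ∧
      ℓ = c' • linearCycleFunctional n d ζ a b hn ∧
      periodVector ℓ = (fun i => c' * linearCyclePeriod n d ζ a b i) ∧
      annIdeal ℓ = linearCycleIdeal n d ζ a b := by
  classical
  have hm : n + 2 = 2 * (n / 2) + 2 := by obtain ⟨r, hr⟩ := hn; omega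
  have hζ0 : ζ ≠ 0 := hζ.ne_zero (by omega)
  obtain ⟨c₀, hrat⟩ := hrat
  -- (H2) in the `(θ, c)` parametrisation
  have hrat' : ∀ (θ : Fin (n / 2 + 1) ⊕ Fin (n / 2 + 1) ≃ Fin (n + 2)) (c : Fin (n / 2 + 1) → K),
      (∀ j, c j ^ d = -1) → ∃ q : ℚ, ℓ (linearCyclePoly (d - 1) θ c) = (q : K) * c₀ := by
    intro θ c hc
    obtain ⟨a, ha⟩ := exists_twist_eq hn (by omega) hζ c hc
    obtain ⟨q, hq⟩ := hrat a ((pairEquiv n hn).symm.trans θ)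
    refine ⟨q, ?_⟩
    rw [← hq, linearCyclePolyMV, ha]
    congr 2
    ext x
    simp
  obtain ⟨θ, c, hc, c', hc', hℓeq⟩ :=
    exists_linearCycle_of_rational_periods hm hd hd6 hζ ℓ hbox hℓ hne hlin ⟨c₀, hrat'⟩
  obtain ⟨a, ha⟩ := exists_twist_eq hn (by omega) hζ c hc
  set b : Equiv.Perm (Fin (n + 2)) := (pairEquiv n hn).symm.trans θ with hb
  have hθ : (pairEquiv n hn).trans b = θ := by ext x; simp [hb]
  -- the unit relating Villaflor's functional and MV18's normalisation
  set u : K := ((Equiv.Perm.sign b : ℤ) : K) * ζ ^ (∑ e : Fin (n / 2 + 1), (1 + 2 * a ⟨2 * e + 1, by omega⟩))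
    with hu
  have hu0 : u ≠ 0 := by
    refine mul_ne_zero ?_ (pow_ne_zero _ hζ0)
    rcases Int.units_eq_one_or (Equiv.Perm.sign b) with h | h <;> simp [h]
  have hLF : linearCycleFunctional n d ζ a b hn =
      u • (fermatLinearCycleFunctional c (d - 1) ∘ₗ
        (rename θ.symm : MvPolynomial (Fin (n + 2)) K →ₐ[K]
          MvPolynomial (Fin (n / 2 + 1) ⊕ Fin (n / 2 + 1)) K).toLinearMap) := by
    rw [linearCycleFunctional, ha, hθ]
  have hℓ' : ℓ = (c' * u⁻¹) • linearCycleFunctional n d ζ a b hn := by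
    rw [hLF, smul_smul, mul_assoc, inv_mul_cancel₀ hu0, mul_one, ← hℓeq]
  refine ⟨a, b, c' * u⁻¹, mul_ne_zero hc' (inv_ne_zero hu0), hℓ', ?_, ?_⟩
  · funext i
    rw [hℓ', periodVector, LinearMap.smul_apply, linearCycleFunctional_monomial, one_mul, smul_eq_mul]
    rfl
  · rw [hℓ', annIdeal_smul _ (mul_ne_zero hc' (inv_ne_zero hu0)),
      annIdeal_linearCycleFunctional ζ a b hn hζ0 (by omega)]

/-- **The fake-linear-cycle shape in the census parametrisation (`d ≥ 3`).** `n` even, `d ≥ 3`, `ζ` a primitive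
`2d`-th root of unity; `ℓ ≠ 0` a period functional on `K[x_0, …, x_{n+1}]` (kills `(x_i^{d−1})`, concentrated in degree
`(n/2+1)(d−2)`) with `n/2 + 1` independent linear forms in `Ann ℓ = J^{F,λ}` and (H2) over the linear cycles `ℙ^{n/2}_{a,b}`
of [MovasatiVillaflor2018]. Then for some permutation `b` and some `c_0, …, c_{n/2} ∈ K^×`,
`ℓ = c'·coeff_{∏_e y_e^{d−2}} ∘ (x_{b(2e)} ↦ c_e y_e, x_{b(2e+1)} ↦ y_e)` (`c' ≠ 0`), i.e.
`J^{F,λ} ∋ x_{b(2e)} − c_e x_{b(2e+1)}` and `P_λ = c_λ ∏_e (x_{b(2e)}^{d−1} − (c_e x_{b(2e+1)})^{d−1})/(x_{b(2e)} − c_e x_{b(2e+1)})`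
— Duque Franco–Villaflor's shape of a FAKE linear cycle (Lemma 4.1; for `d = 3, 4, 6` such `λ` need not be `[ℙ^{n/2}]`,
op. cit. Theorem 1.1) — with, for each `e`, all ratios `y Σ_l c_e^l y^{d−2−l} / (x Σ_l c_e^l x^{d−2−l})` (`x^d = y^d = −1`)
rational. [cite: DuquefrancoVillaflorloyola2023, Lemma 4.1] [cite: Villaflorloyola2021, Remark 5.1 and proof of Theorem 1.2]
[cite: MovasatiVillaflor2018, §1] -/
theorem exists_fakeLinearCycleFunctional_of_rational_periods [CharZero K] (hn : Even n) (hd : 3 ≤ d)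
    (hζ : IsPrimitiveRoot ζ (2 * d)) (ℓ : MvPolynomial (Fin (n + 2)) K →ₗ[K] K)
    (hbox : ∀ s : Fin (n + 2) →₀ ℕ, (∃ i, d - 1 ≤ s i) → ℓ (monomial s 1) = 0)
    (hℓ : ∀ q, ℓ (homogeneousComponent ((n / 2 + 1) * (d - 2)) q) = ℓ q) (hne : ℓ ≠ 0)
    (hlin : n / 2 + 1 ≤ finrank K (idealDegree (annIdeal ℓ) 1))
    (hrat : ∃ c₀ : K, ∀ (a : Fin (n + 2) → ℕ) (b : Equiv.Perm (Fin (n + 2))),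
      ∃ q : ℚ, ℓ (linearCyclePolyMV n d ζ a b hn) = (q : K) * c₀) :
    ∃ (b : Equiv.Perm (Fin (n + 2))) (c : Fin (n / 2 + 1) → K) (c' : K), (∀ j, c j ≠ 0) ∧
      (∀ j (x y : K), x ^ d = -1 → y ^ d = -1 → pairPeriod d (c j) x ≠ 0 →
        ∃ q : ℚ, pairPeriod d (c j) y = (q : K) * pairPeriod d (c j) x) ∧ c' ≠ 0 ∧
      ℓ = c' • (fermatLinearCycleFunctional c (d - 1) ∘ₗ
        (rename ((pairEquiv n hn).trans b).symm : MvPolynomial (Fin (n + 2)) K →ₐ[K]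
          MvPolynomial (Fin (n / 2 + 1) ⊕ Fin (n / 2 + 1)) K).toLinearMap) := by
  classical
  have hm : n + 2 = 2 * (n / 2) + 2 := by obtain ⟨r, hr⟩ := hn; omega
  obtain ⟨c₀, hrat⟩ := hrat
  -- (H2) in the `(θ, c)` parametrisation
  have hrat' : ∀ (θ : Fin (n / 2 + 1) ⊕ Fin (n / 2 + 1) ≃ Fin (n + 2)) (c : Fin (n / 2 + 1) → K),
      (∀ j, c j ^ d = -1) → ∃ q : ℚ, ℓ (linearCyclePoly (d - 1) θ c) = (q : K) * c₀ := by
    intro θ c hc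
    obtain ⟨a, ha⟩ := exists_twist_eq hn (by omega) hζ c hc
    obtain ⟨q, hq⟩ := hrat a ((pairEquiv n hn).symm.trans θ)
    refine ⟨q, ?_⟩
    rw [← hq, linearCyclePolyMV, ha]
    congr 2
    ext x
    simp
  obtain ⟨θ, c, hc0, hratio, c', hc', hℓeq⟩ :=
    exists_fakeLinearCycle_of_rational_periods hm hd hζ ℓ hbox hℓ hne hlin ⟨c₀, hrat'⟩
  refine ⟨(pairEquiv n hn).symm.trans θ, c, c', hc0, hratio, hc', ?_⟩
  have hθ : (pairEquiv n hn).trans ((pairEquiv n hn).symm.trans θ) = θ := by ext x; simp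
  rw [hθ]
  exact hℓeq

/-- The degree bookkeeping in the census indices. [cite: Movasati2016Periods, Definition 1] -/
private theorem col_add_row_eq_census (hn : Even n) (hN : n + 2 ≤ n / 2 * d) :
    d + (n / 2 * d - n - 2) = (n / 2 + 1) * (d - 2) := by
  have hk : n = 2 * (n / 2) := by obtain ⟨r, hr⟩ := hn; omega
  have h := col_add_row_eq (k := n / 2) (d := d) (by omega)
  rw [show n / 2 * d - n - 2 = n / 2 * d - 2 * (n / 2) - 2 by omega]
  exact h

/-- **Villaflor, Theorem 1.1 in the census parametrisation** ("The equality in (cota) holds if and only if `Σ` is the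
locus of hypersurfaces containing a linear subvariety of dimension `n/2` … `codim T_0V_λ = C(n/2+d,d) − (n/2+1)²` iff
`λ(0)_prim = a[ℙ^{n/2}]_prim`"), the "only if" at the level of Movasati's matrix: `n` even, `d ≥ 2 + 6/n`
(`d + 1 ≤ (n/2+1)(d−2)`), `d ∉ {3, 4, 6}`, `ζ` a primitive `2d`-th root of unity. If a period vector `p = p(λ)`
(`ℓ ≠ 0` killing `J^F`, concentrated in degree `σ`) has **`rank [p_{i+j}] = C(n/2+d, d) − (n/2+1)²`** (tree
`Movasati2016.periodMatrix (n+2) d ((n/2)d−n−2) d`, the census matrix) and satisfies (H2), then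
`p = c'·p(ℙ^{n/2}_{a,b})` for a linear cycle of the Fermat variety and `J^{F,λ} = J^{F,[ℙ^{n/2}_{a,b}]}`. The "if" is
`MovasatiVillaflor2018.rank_periodMatrix_linearCycle`. [cite: Villaflorloyola2021, Theorem 1.1, Proposition 4.1]
[cite: Movasati2016Periods, Theorem 6] [cite: MovasatiVillaflor2018, Theorem 1, Proposition 1] -/
theorem exists_linearCycleFunctional_of_rank_eq [CharZero K] (hn : Even n) (hd : 5 ≤ d) (hd6 : d ≠ 6)
    (hσ : d + 1 ≤ (n / 2 + 1) * (d - 2)) (hζ : IsPrimitiveRoot ζ (2 * d))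
    (ℓ : MvPolynomial (Fin (n + 2)) K →ₗ[K] K)
    (hbox : ∀ s : Fin (n + 2) →₀ ℕ, (∃ i, d - 1 ≤ s i) → ℓ (monomial s 1) = 0)
    (hℓ : ∀ q, ℓ (homogeneousComponent ((n / 2 + 1) * (d - 2)) q) = ℓ q) (hne : ℓ ≠ 0)
    (hrank : (periodMatrix (n + 2) d (n / 2 * d - n - 2) d (periodVector ℓ)).rank =
      (n / 2 + d).choose d - (n / 2 + 1) ^ 2)
    (hrat : ∃ c₀ : K, ∀ (a : Fin (n + 2) → ℕ) (b : Equiv.Perm (Fin (n + 2))),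
      ∃ q : ℚ, ℓ (linearCyclePolyMV n d ζ a b hn) = (q : K) * c₀) :
    ∃ (a : Fin (n + 2) → ℕ) (b : Equiv.Perm (Fin (n + 2))) (c' : K), c' ≠ 0 ∧
      ℓ = c' • linearCycleFunctional n d ζ a b hn ∧
      periodVector ℓ = (fun i => c' * linearCyclePeriod n d ζ a b i) ∧
      annIdeal ℓ = linearCycleIdeal n d ζ a b := by
  have hk : n = 2 * (n / 2) := by obtain ⟨r, hr⟩ := hn; omega
  have hN : n + 2 ≤ n / 2 * d := by
    have h1 : (n / 2 + 1) * (d - 2) = n / 2 * d - n + (d - 2) := by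
      zify [(by omega : 2 ≤ d), (by nlinarith : n ≤ n / 2 * d)]
      nlinarith
    omega
  have heq : finrank K (homogeneousSubmodule (Fin (n + 2)) K d) - finrank K (idealDegree (annIdeal ℓ) d) =
      (n / 2 + d).choose d - (n / 2 + 1) ^ 2 := by
    rw [← hrank, rank_periodMatrix_eq_hilbert ℓ hbox hℓ (col_add_row_eq_census hn hN)]
  have h1 := Movasati2017.hilbert_annIdeal_one_eq_of_hilbert_eq (by omega) hσ ℓ hbox hℓ rfl hne heq
  have hS1 : finrank K (homogeneousSubmodule (Fin (n + 2)) K 1) = n + 2 := finrank_homogeneousSubmodule_one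
  haveI : Module.Finite K (homogeneousSubmodule (Fin (n + 2)) K 1) := finite_homogeneousSubmodule 1
  have hle : finrank K (idealDegree (annIdeal ℓ) 1) ≤ finrank K (homogeneousSubmodule (Fin (n + 2)) K 1) :=
    Submodule.finrank_mono (idealDegree_le_homogeneousSubmodule _ 1)
  exact exists_linearCycleFunctional_of_rational_periods hn hd hd6 hζ ℓ hbox hℓ hne (by omega) hrat

end Census

end Literature.AlgebraicGeometry.Villaflor2022

end
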